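import Mathlib
import Literature.NumberTheory.Automorphic.ModularEisensteinCriticalLine
import Literature.NumberTheory.Automorphic.MaassCuspForms
import Literature.NumberTheory.Automorphic.RoelckeSelbergBound

/-!
# Orthogonality of cusp forms and constants to the Eisenstein series of `SL₂(ℤ)`
(Iwaniec, *Spectral Methods of Automorphic Forms*, GSM 53, (3.26)–(3.27), PDF p. 47; §3.2 and
(7.4) (unfolding), PDF pp. 42, 98; (7.11)–(7.13) and Theorem 7.3, PDF pp. 100–101)

Layer 24 of the `provefact` decomposition of `Literature.NumberTheory.Automorphic.sl2BallCount_asymp`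
(`HyperbolicLatticeCount.lean`), the first layer on the continuous spectrum: to identify the
Eisenstein coefficients of an automorphic kernel in the spectral expansion (7.17) one needs that the
residual eigenfunction `u₀ = const` and the Maass cusp forms `u_j` are orthogonal to the Eisenstein
series `E(·, 1/2 + ir)` on the fundamental domain (the orthogonality of the three parts of
`L²(Γ\ℍ) = ℂ ⊕ 𝓒 ⊕ 𝓔`, Thm 7.3). Iwaniec obtains this from (7.13) (incomplete Eisenstein series are
orthogonal to cusp forms, by unfolding) and analytic continuation. Here, for `Γ = SL₂(ℤ)`, we avoid
continuation in `s` altogether: `E*(z, s) = ½Λ_z(s)` is the Mellin transform of the theta function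
`Θ_z(t)` of the lattice (`ModularEisensteinContinuation.lean`), and **`Θ_z(t) - 1` is itself an
incomplete-Eisenstein-type sum**, which unfolds. Everything here is proved; nothing is vendored.

1. **`E(z, s)` for all `s`** (`eisen z s = E*(z,s)/Λ(2s)`, `Λ` = Mathlib's `completedRiemannZeta`):
   agrees with the series `eisensteinE` for `Re s > 1` ((3.27)), with `eisensteinCrit` on the
   critical line, is automorphic, `C²` with `(Δ + s(1-s))E = 0`, and has residue `3/π` at `s = 1`
   (`tendsto_sub_one_mul_eisen`; `Res E* = 1/2`, `Λ(2) = π/6`).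
2. **Cosets `Γ∞\Γ` versus matrices** (`cosetEquiv : SL₂(ℤ) ≃ (coprime pairs) × ℤ`,
   `g ↦ (bottom row, power of T)`), whence the coset-to-matrix identity
   `Σ_{g ∈ SL₂(ℤ)} 𝟙_{S'}(gw) Ψ(gw) = Σ_{(c,d)=1} Ψ(γ_{c,d} w)` for `1`-periodic `Ψ` and the strip
   `S' = {0 ≤ Re w < 1}` (`hasSum_indicator_stripFD_mul`, and in `[0,∞]`), and — with the unfolding
   of `FundamentalDomainUnfolding.lean` — **unfolding against coset sums**:
   `∫_𝒟 u(w) Σ_{(c,d)=1} Ψ(γ_{c,d}w) dμ = 2∫_{S'} Ψ u dμ` for automorphic `u` (Bochner and Lebesgue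
   versions, `setIntegral_fd_mul_tsum_coset`, `setLIntegral_fd_mul_tsum_coset`); Tonelli/Fubini on
   the strip, `∫_{S'} F dμ = ∫_0^∞ (∫_{[0,1)} F(x+iy) dx) y⁻² dy`.
3. **Cusp forms are orthogonal to constants** (`IsMaassCuspForm.setIntegral_fd_eq_zero`): the
   symmetric operator `T_{k₁}` (`k₁ ≥ 0` the kernel of `ModularPartitionOfUnity.lean`) has the
   eigenvalue `h(i/2) = ∫g cosh(r/2) dr` on constants and `h(t)` with `Re h(t) = ∫ g cos(rt) dr < h(i/2)`
   (`re_selbergTransform_lt`, `g ≥ 0`, `g > 0` near `0`) on a cusp form with real `t`.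
4. **`Θ - 1` sorted by the gcd** (`tsum_thetaTerm_eq_tsum_coset`):
   `Θ_z(t) - 1 = Σ_{r≥1} Σ_{(c,d)=1} e^{-πtr²/Im(γ_{c,d}z)}`, so by 2 its mass on `𝒟` is
   `Σ_r 2∫_0^∞ e^{-πtr²/y} y⁻² dy = Σ_r 2/(πtr²) = π/(3t)` (`lintegral_fd_thetaQ_sub_one`), and
   **`∫_𝒟 u (Θ(t) - 1) dμ = 0`** for every bounded automorphic `u` with vanishing horizontal means
   (`setIntegral_fd_mul_thetaQ_sub_one_eq_zero`).
5. **Fubini** (`integral_fd_mul_Lambda₀`, for `0 < Re s < 1`): for a bounded weight `φ` on `𝒟`,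
   `∫_𝒟 φ Λ₀(s) dμ = ∫_0^∞ t^{s-1} ∫_𝒟 φ(w) f_modif,w(t) dμ(w) dt`, the majorant
   `|φ| t^{σ-1} |f_modif|` having product integral `B(π/3)(1/σ + 1/(1-σ))` by 4 and the functional
   equation `Θ_w(t) - 1/t = (Θ_w(1/t) - 1)/t ≥ 0`.
6. **Orthogonality** (`0 < Re s < 1`, in particular `s = 1/2 + ir`):
   `∫_𝒟 ū E(·, s) dμ = 0` for every square-integrable Maass cusp form `u` of `SL₂(ℤ)` with real
   spectral parameter (`IsMaassCuspForm.integral_fd_conj_mul_eisen(steinCrit)`; by 3, 4, 5), and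
   `∫_𝒟 E(·, s) dμ = 0` (`integral_fd_eisen_eq_zero`; `∫_𝒟 Λ₀ = (π/3)(1/s + 1/(1-s))` cancels the
   polar part, `|𝒟| = π/3`).

Mathlib: `completedRiemannZeta`, `riemannZeta_def_of_ne_zero`, `riemannZeta_ne_zero_of_one_le_re`,
`riemannZeta_two`, `hasSum_zeta_two`, `WeakFEPair.Λ`/`Λ₀`/`f_modif`, `EisensteinSeries.gammaSet…
(DivGcd)Equiv`, `ModularGroup.coe_T_zpow`, `SpecialLinearGroup.SL2_inv_expl`, `MonoidHom.ofInjective`,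
`ENNReal.tsum_prod'`, `HasSum.prod_fiberwise`, `summable_sigma_of_nonneg`, `lintegral_prod_symm`,
`integral_integral_swap`, `integral_Ioi_of_hasDerivAt_of_nonneg`, `integral_cpow`,
`integral_Ioi_cpow_of_lt`, `MeasurableEmbedding.invFun`, `L2.inner_def`. Literature:
`completedEisenstein(_eq/_smul/_eq_theta_mul)`, `thetaQ`, `qForm`, `thetaFEPair`,
`hasSum_thetaQ_sub_one`, `thetaQ_functional_equation`, `one_le_thetaQ`, `continuous_thetaQ_left`
(`ModularEisensteinContinuation.lean`); `eisensteinCrit`, `critS`, `thetaHat_eq`,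
`isC2_and_eigen_completedEisenstein`, `f_modif_thetaFEPair`, `aestronglyMeasurable_f_modif_prod`
(`ModularEisensteinCriticalLine.lean`); `eisensteinE`, `exists_SL2Z_row` (`ModularEisensteinSeries.lean`);
`IsMaassCuspForm`, `locKernel`, `IsMaassCuspForm.exists_norm_sq_le`, `intervalIntegral_pt_eq_cuspMean`
(`MaassCuspForms.lean`, `ModularPartitionOfUnity.lean`, `RoelckeSelbergBound.lean`);
`kernelCLM_toLp_eigenfunction`, `kernelCLM_toLp_const`, `kernelCLM_isSymmetric`
(`AutomorphicKernelOperators.lean`); `selbergTransform_I_half`, `integral_exp_mul_selbergG`,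
`integrableOn_selbergQ_integrand` (`SelbergTransform.lean`); `setIntegral_tsum_smul_eq`,
`setLIntegral_tsum_smul_eq` (`FundamentalDomainUnfolding.lean`); `volume_modular_fd`,
`modular_fd_covers` (`HyperbolicLaplaceSpectrum.lean`); `pt` & co. (`HyperbolicDirichletForm.lean`).
Neither Mathlib nor Literature had `E(z,s)` off the half-plane of convergence as a function, the
coset device, or the orthogonality statements (`lean search 'eisen |cosetEquiv|rowRep|thetaQ_sub_one|orthogonal.*Eisenstein'`).

## References
* [Iwaniec2002] H. Iwaniec, *Spectral Methods of Automorphic Forms*, 2nd ed., GSM 53, AMS 2002,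
  (3.26)–(3.27), PDF p. 47; §3.2, PDF p. 42; (7.4), PDF p. 98; (7.11)–(7.13) & Thm 7.3,
  PDF pp. 100–101; Cor. 4.4, PDF p. 50; §7.2, PDF p. 73.
-/

noncomputable section

open MeasureTheory Set Filter Real UpperHalfPlane
open scoped Topology MatrixGroups ComplexConjugate NNReal ENNReal Modular

namespace Literature.NumberTheory.Automorphic

/-- **The Eisenstein series of `SL₂(ℤ)` for all `s`**: `E(z, s) = E*(z, s) / Λ(2s)` with
`Λ(w) = π^{-w/2} Γ(w/2) ζ(w)` Mathlib's completed zeta (`completedRiemannZeta`); this is the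
meromorphic continuation of `eisensteinE` ((3.27): `E* = θ(s) E`, `θ(s) = π^{-s}Γ(s)ζ(2s) = Λ(2s)`).
[cite: Iwaniec2002, (3.27), PDF p. 47] -/
def eisen (z : ℍ) (s : ℂ) : ℂ := completedEisenstein z s / completedRiemannZeta (2 * s)

/-- `Λ(2s) = π^{-s} Γ(s) ζ(2s)` for `Re s > 0`. [folklore] -/
theorem completedRiemannZeta_two_mul {s : ℂ} (hs : 0 < s.re) :
    completedRiemannZeta (2 * s) = (π : ℂ) ^ (-s) * Complex.Gamma s * riemannZeta (2 * s) := by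
  have hs0 : s ≠ 0 := fun h => by rw [h, Complex.zero_re] at hs; exact lt_irrefl _ hs
  have h2 : (2 : ℂ) * s ≠ 0 := mul_ne_zero two_ne_zero hs0
  have hG : Complex.Gammaℝ (2 * s) = (π : ℂ) ^ (-s) * Complex.Gamma s := by
    rw [Complex.Gammaℝ_def]
    congr 2 <;> ring
  rw [riemannZeta_def_of_ne_zero h2, hG]
  have hΓ : Complex.Gamma s ≠ 0 := Complex.Gamma_ne_zero_of_re_pos hs
  have hπ : (π : ℂ) ^ (-s) ≠ 0 := by rw [Ne, Complex.cpow_eq_zero_iff, not_and_or]; exact Or.inl (by exact_mod_cast Real.pi_pos.ne')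
  field_simp

/-- **`E(z, s) = eisensteinE z s` for `Re s > 1`** (the continuation agrees with the series). [cite: Iwaniec2002, (3.27), PDF p. 47] -/
theorem eisen_eq_eisensteinE (z : ℍ) {s : ℂ} (hs : 1 < s.re) : eisen z s = eisensteinE z s := by
  unfold eisen
  rw [completedEisenstein_eq_theta_mul z hs, completedRiemannZeta_two_mul (by linarith)]
  have hΓ : Complex.Gamma s ≠ 0 := Complex.Gamma_ne_zero_of_re_pos (by linarith)
  have hπ : (π : ℂ) ^ (-s) ≠ 0 := by rw [Ne, Complex.cpow_eq_zero_iff, not_and_or]; exact Or.inl (by exact_mod_cast Real.pi_pos.ne')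
  have hζ : riemannZeta (2 * s) ≠ 0 := riemannZeta_ne_zero_of_one_lt_re (by simp; linarith)
  field_simp
  rw [mul_comm s 2]
  field_simp

/-- `Λ(2s) ≠ 0` for `Re s ≥ 1/2`, `s ≠ 1/2` (non-vanishing of `ζ` on `Re ≥ 1`). [folklore] -/
theorem completedRiemannZeta_two_mul_ne_zero {s : ℂ} (hs : 1 / 2 ≤ s.re) (hs' : s ≠ 1 / 2) :
    completedRiemannZeta (2 * s) ≠ 0 := by
  rw [completedRiemannZeta_two_mul (by linarith)]
  have hΓ : Complex.Gamma s ≠ 0 := Complex.Gamma_ne_zero_of_re_pos (by linarith)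
  have hπ : (π : ℂ) ^ (-s) ≠ 0 := by rw [Ne, Complex.cpow_eq_zero_iff, not_and_or]; exact Or.inl (by exact_mod_cast Real.pi_pos.ne')
  have h2s1 : (2 : ℂ) * s ≠ 1 := fun h => hs' (by linear_combination h / 2)
  have hζ : riemannZeta (2 * s) ≠ 0 := riemannZeta_ne_zero_of_one_le_re (by simp; linarith)
  exact mul_ne_zero (mul_ne_zero hπ hΓ) hζ

/-- **On the critical line `E(z, 1/2 + ir) = eisensteinCrit z r`** (the normalisation of
`ModularEisensteinCriticalLine.lean`: `critFactor r = 1/Λ(1 + 2ir)`). [folklore] -/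
theorem eisen_critS (z : ℍ) {r : ℝ} (hr : r ≠ 0) : eisen z (critS r) = eisensteinCrit z r := by
  unfold eisen eisensteinCrit critFactor
  have h0 := critS_ne_zero r
  have hhalf : critS r ≠ 1 / 2 := by
    intro h; have := congrArg Complex.im h; simp [critS, hr] at this
  rw [thetaHat_eq h0 hhalf]
  have hΛ : completedRiemannZeta (2 * critS r) ≠ 0 :=
    completedRiemannZeta_two_mul_ne_zero (by simp [critS]) hhalf
  have hc' : (1 - 2 * critS r) ≠ 0 := by
    intro h; apply hhalf; linear_combination -h / 2
  have hc : 2 * critS r * (1 - 2 * critS r) ≠ 0 := mul_ne_zero (mul_ne_zero two_ne_zero h0) hc'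
  field_simp

/-- `E(·, s)` is `SL₂(ℤ)`-invariant. [cite: Iwaniec2002, §3.1 (3.1), PDF p. 40] -/
theorem eisen_smul (A : SL(2, ℤ)) (z : ℍ) (s : ℂ) : eisen (A • z) s = eisen z s := by
  unfold eisen; rw [completedEisenstein_smul]

/-- `E(·, s)` is automorphic for the modular group (as a subgroup of `GL₂(ℝ)`). [folklore] -/
theorem isAutomorphic_eisen (s : ℂ) : IsAutomorphic (𝒮ℒ : Subgroup (GL (Fin 2) ℝ)) (fun z => eisen z s) := by
  intro γ hγ z
  obtain ⟨g, rfl⟩ := hγ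
  have e : (Matrix.SpecialLinearGroup.mapGL ℝ g : GL (Fin 2) ℝ) • z = g • z := rfl
  show eisen ((Matrix.SpecialLinearGroup.mapGL ℝ g : GL (Fin 2) ℝ) • z) s = eisen z s
  rw [e, eisen_smul]

/-- `E(·, s)` is `C²` with `(Δ + s(1-s)) E(·, s) = 0`, for `s ≠ 0, 1`.
[cite: Iwaniec2002, §3.1 (3.2) & (1.17), PDF pp. 15, 40] -/
theorem isC2_and_eigen_eisen {s : ℂ} (hs0 : s ≠ 0) (hs1 : s ≠ 1) :
    IsC2 (fun z => eisen z s) ∧ ∀ z, hypLaplacian (fun z => eisen z s) z + s * (1 - s) * eisen z s = 0 := by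
  obtain ⟨hC2, heig⟩ := isC2_and_eigen_completedEisenstein hs0 hs1
  have e : (fun z => eisen z s) = fun z => (completedRiemannZeta (2 * s))⁻¹ * completedEisenstein z s := by
    funext z; unfold eisen; rw [div_eq_inv_mul]
  rw [e]
  refine ⟨hC2.const_mul _, fun z => ?_⟩
  rw [hypLaplacian_const_mul' hC2]
  have := heig z
  simp only [eisen, div_eq_inv_mul]
  linear_combination (completedRiemannZeta (2 * s))⁻¹ * this

/-- `Λ(2) = π/6`. [folklore] -/
theorem completedRiemannZeta_two' : completedRiemannZeta 2 = (π : ℂ) / 6 := by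
  have h := completedRiemannZeta_two_mul (s := 1) (by simp)
  rw [mul_one] at h
  rw [h, Complex.Gamma_one, riemannZeta_two]
  have hπ : (π : ℂ) ≠ 0 := by exact_mod_cast Real.pi_pos.ne'
  rw [Complex.cpow_neg_one]
  field_simp

/-- **The residue of `E(z, s)` at `s = 1` is `3/π`** ((3.26): `Res E* = 1/2`, `Λ(2) = π/6`).
[cite: Iwaniec2002, (3.26), PDF p. 47] -/
theorem tendsto_sub_one_mul_eisen (z : ℍ) :
    Tendsto (fun s => (s - 1) * eisen z s) (𝓝[≠] 1) (𝓝 ((3 / π : ℝ) : ℂ)) := by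
  -- `(s - 1) E*(z, s) = (s - 1) E*₀(z, s) - (s - 1)/(2s) + 1/2 → 1/2`
  have hnum : Tendsto (fun s => (s - 1) * completedEisenstein z s) (𝓝[≠] 1) (𝓝 (1 / 2)) := by
    have hcont₀ : ContinuousAt (fun s => completedEisenstein₀ z s) 1 :=
      (differentiable_completedEisenstein₀ z 1).continuousAt
    have h1 : Tendsto (fun s : ℂ => (s - 1) * completedEisenstein₀ z s - (s - 1) / (2 * s) + 1 / 2) (𝓝 1)
        (𝓝 ((1 - 1) * completedEisenstein₀ z 1 - (1 - 1) / (2 * 1) + 1 / 2)) := by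
      refine ((((continuous_id.sub continuous_const).continuousAt).mul hcont₀).sub ?_).add continuousAt_const |>.tendsto
      exact ((continuous_id.sub continuous_const).continuousAt).div (continuousAt_const.mul continuousAt_id) (by norm_num)
    simp only [sub_self, zero_mul, zero_div, zero_add] at h1
    refine (h1.mono_left nhdsWithin_le_nhds).congr' ?_
    filter_upwards [self_mem_nhdsWithin] with s hs
    rw [completedEisenstein_eq]
    have hs1 : (1 : ℂ) - s ≠ 0 := sub_ne_zero.mpr (Ne.symm hs)
    field_simp
    ring
  have hden : Tendsto (fun s => completedRiemannZeta (2 * s)) (𝓝[≠] (1 : ℂ)) (𝓝 ((π : ℂ) / 6)) := by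
    rw [← completedRiemannZeta_two', show (2 : ℂ) = 2 * 1 by ring]
    refine ((differentiableAt_completedZeta (s := 2 * 1) (by norm_num) (by norm_num)).continuousAt.comp
      (continuousAt_const.mul continuousAt_id)).tendsto.mono_left nhdsWithin_le_nhds |>.congr fun s => ?_
    simp
  have hπ6 : (π : ℂ) / 6 ≠ 0 := div_ne_zero (by exact_mod_cast Real.pi_pos.ne') (by norm_num)
  have h := hnum.div hden hπ6
  have e : ((3 / π : ℝ) : ℂ) = (1 / 2) / ((π : ℂ) / 6) := by
    have hπ : (π : ℂ) ≠ 0 := by exact_mod_cast Real.pi_pos.ne'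
    push_cast; field_simp; ring
  rw [e]
  refine h.congr fun s => ?_
  simp only [Pi.div_apply, eisen]
  ring

/-! ## Cosets `Γ∞\Γ` versus matrices: the strip `0 ≤ Re w < 1` -/

section Coset

open EisensteinSeries ModularGroup

/-- The strip `S' = {0 ≤ Re w < 1}`, a fundamental domain of `Γ∞ = {T^n}`. [folklore] -/
def stripFD : Set ℍ := {w : ℍ | 0 ≤ w.re ∧ w.re < 1}

/-- `S'` is measurable. [folklore] -/
theorem measurableSet_stripFD : MeasurableSet stripFD :=
  (isClosed_le continuous_const UpperHalfPlane.continuous_re).measurableSet.inter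
    (isOpen_lt UpperHalfPlane.continuous_re continuous_const).measurableSet

/-- The integer translate landing in the strip is `n = -⌊Re w⌋`, and it is unique. [folklore] -/
theorem int_vadd_mem_stripFD_iff (w : ℍ) (n : ℤ) : ((n : ℝ) +ᵥ w) ∈ stripFD ↔ n = -⌊w.re⌋ := by
  simp only [stripFD, mem_setOf_eq, vadd_re]
  constructor
  · rintro ⟨h1, h2⟩
    have : ⌊w.re⌋ = -n := by
      rw [Int.floor_eq_iff]; push_cast; constructor <;> linarith
    omega
  · rintro rfl
    push_cast
    constructor <;> linarith [Int.floor_le w.re, Int.lt_floor_add_one w.re]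

/-- A representative of the coset with bottom row `v`. [folklore] -/
def rowRep (v : gammaSet 1 1 0) : SL(2, ℤ) := Classical.choose (exists_SL2Z_row v.2)

/-- Its bottom row is `v`. [folklore] -/
theorem rowRep_spec (v : gammaSet 1 1 0) : rowRep v 1 0 = (v : Fin 2 → ℤ) 0 ∧ rowRep v 1 1 = (v : Fin 2 → ℤ) 1 :=
  Classical.choose_spec (exists_SL2Z_row v.2)

/-- The bottom row of a matrix, a coprime pair. [folklore] -/
def botRow (g : SL(2, ℤ)) : gammaSet 1 1 0 :=
  ⟨![g 1 0, g 1 1], (mem_gammaSet_one _).mpr (by simpa using ModularGroup.bottom_row_coprime g)⟩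

/-- `botRow (rowRep v) = v`. [folklore] -/
theorem botRow_rowRep (v : gammaSet 1 1 0) : botRow (rowRep v) = v := by
  apply Subtype.ext
  funext i
  fin_cases i
  · simpa [botRow] using (rowRep_spec v).1
  · simpa [botRow] using (rowRep_spec v).2

/-- Left multiplication by `T^n` does not change the bottom row. [folklore] -/
theorem botRow_T_zpow_mul (n : ℤ) (g : SL(2, ℤ)) : botRow (T ^ n * g) = botRow g := by
  apply Subtype.ext
  funext i
  fin_cases i <;> simp [botRow]

/-- The `T`-exponent of a matrix relative to the representative of its coset. [folklore] -/
def tExp (g : SL(2, ℤ)) : ℤ := (g * (rowRep (botRow g))⁻¹) 0 1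

/-- **`g = T^{n(g)} · rowRep (bottom row of g)`.** [folklore] -/
theorem eq_T_zpow_mul_rowRep (g : SL(2, ℤ)) : g = T ^ tExp g * rowRep (botRow g) := by
  set v := botRow g with hv
  set h : SL(2, ℤ) := g * (rowRep v)⁻¹ with hh
  have hg : g = h * rowRep v := by rw [hh, inv_mul_cancel_right]
  have hr := rowRep_spec v
  have hv0 : (v : Fin 2 → ℤ) 0 = g 1 0 := rfl
  have hv1 : (v : Fin 2 → ℤ) 1 = g 1 1 := rfl
  have hdet : (rowRep v) 0 0 * (rowRep v) 1 1 - (rowRep v) 0 1 * (rowRep v) 1 0 = 1 := by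
    have := (rowRep v).det_coe; rw [Matrix.det_fin_two] at this; exact this
  have hgdet : g 0 0 * g 1 1 - g 0 1 * g 1 0 = 1 := by
    have := g.det_coe; rw [Matrix.det_fin_two] at this; exact this
  have hinv := Matrix.SpecialLinearGroup.SL2_inv_expl (rowRep v)
  have hc : h 1 0 = 0 := by
    simp only [hh, Matrix.SpecialLinearGroup.coe_mul, hinv, Matrix.mul_apply, Fin.sum_univ_two]
    simp [hr.1, hr.2, hv0, hv1]; ring
  have hd : h 1 1 = 1 := by
    simp only [hh, Matrix.SpecialLinearGroup.coe_mul, hinv, Matrix.mul_apply, Fin.sum_univ_two]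
    simp [hr.1, hr.2, hv0, hv1]
    rw [hr.1, hr.2, hv0, hv1] at hdet
    linear_combination hdet
  have ha : h 0 0 = 1 := by
    have := h.det_coe; rw [Matrix.det_fin_two, hc, hd] at this; simpa using this
  have hT : h = T ^ tExp g := by
    have e : tExp g = h 0 1 := rfl
    rw [e]
    ext i j
    fin_cases i <;> fin_cases j <;> simp [ha, hc, hd, ModularGroup.coe_T_zpow]
  rw [← hT]
  exact hg

/-- The `T`-exponent of `T^n · rowRep v` is `n`. [folklore] -/
theorem tExp_T_zpow_mul_rowRep (n : ℤ) (v : gammaSet 1 1 0) : tExp (T ^ n * rowRep v) = n := by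
  unfold tExp
  rw [botRow_T_zpow_mul, botRow_rowRep, mul_inv_cancel_right]
  simp [ModularGroup.coe_T_zpow]

/-- **`SL₂(ℤ) ≃ (Γ∞\Γ) × ℤ`**: `g ↦ (bottom row, power of T)`. [folklore] -/
def cosetEquiv : SL(2, ℤ) ≃ gammaSet 1 1 0 × ℤ where
  toFun g := (botRow g, tExp g)
  invFun p := T ^ p.2 * rowRep p.1
  left_inv g := (eq_T_zpow_mul_rowRep g).symm
  right_inv p := by
    obtain ⟨v, n⟩ := p
    simp only [Prod.mk.injEq]
    exact ⟨by rw [botRow_T_zpow_mul, botRow_rowRep], tExp_T_zpow_mul_rowRep n v⟩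

/-- The action of `T^n · rowRep v`. [folklore] -/
theorem cosetEquiv_symm_smul (p : gammaSet 1 1 0 × ℤ) (w : ℍ) :
    cosetEquiv.symm p • w = (p.2 : ℝ) +ᵥ (rowRep p.1 • w) := by
  show (T ^ p.2 * rowRep p.1) • w = _
  rw [mul_smul, modular_T_zpow_smul]

/-- **The coset-to-matrix identity**: for a `1`-periodic `Ψ`,
`Σ_{g ∈ SL₂(ℤ)} 𝟙_{S'}(g w) Ψ(g w) = Σ_{(c,d) = 1} Ψ(γ_{c,d} w)` (each coset `Γ∞ γ` has exactly one
member mapping `w` into the strip). [cite: Iwaniec2002, §3.1 (3.1) & §2.2, PDF pp. 28, 40] -/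
theorem hasSum_indicator_stripFD_mul {Ψ : ℍ → ℂ} (hΨ : ∀ (n : ℤ) (w : ℍ), Ψ ((n : ℝ) +ᵥ w) = Ψ w) (w : ℍ)
    (hs : Summable fun v : gammaSet 1 1 0 => ‖Ψ (rowRep v • w)‖) :
    HasSum (fun g : SL(2, ℤ) => stripFD.indicator (fun _ => (1 : ℂ)) (g • w) * Ψ (g • w))
      (∑' v : gammaSet 1 1 0, Ψ (rowRep v • w)) := by
  rw [← cosetEquiv.symm.hasSum_iff]
  set F : gammaSet 1 1 0 × ℤ → ℂ := fun p =>
    stripFD.indicator (fun _ => (1 : ℂ)) ((p.2 : ℝ) +ᵥ (rowRep p.1 • w)) * Ψ (rowRep p.1 • w) with hF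
  have hfun : (fun g : SL(2, ℤ) => stripFD.indicator (fun _ => (1 : ℂ)) (g • w) * Ψ (g • w)) ∘ cosetEquiv.symm = F := by
    funext p
    simp only [Function.comp_apply, hF, cosetEquiv_symm_smul, hΨ]
  rw [hfun]
  -- off the unique `n₀(v)` the terms vanish
  have hzero : ∀ (v : gammaSet 1 1 0) (n : ℤ), n ≠ -⌊(rowRep v • w).re⌋ → F (v, n) = 0 := by
    intro v n hn
    simp only [hF]
    rw [Set.indicator_of_notMem (fun h => hn ((int_vadd_mem_stripFD_iff _ n).mp h)), zero_mul]
  have hone : ∀ v : gammaSet 1 1 0, F (v, -⌊(rowRep v • w).re⌋) = Ψ (rowRep v • w) := by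
    intro v
    simp only [hF, Set.indicator_of_mem ((int_vadd_mem_stripFD_iff _ _).mpr rfl), one_mul]
  have hfib : ∀ v : gammaSet 1 1 0, HasSum (fun n : ℤ => F (v, n)) (Ψ (rowRep v • w)) := by
    intro v
    rw [← hone v]
    exact hasSum_single _ fun n hn => hzero v n hn
  -- summability on the product via non-negativity of norms
  have hnorm : Summable fun p : gammaSet 1 1 0 × ℤ => ‖F p‖ := by
    rw [← (Equiv.sigmaEquivProd (gammaSet 1 1 0) ℤ).summable_iff]
    refine (summable_sigma_of_nonneg fun _ => norm_nonneg _).mpr ⟨fun v => ?_, ?_⟩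
    · refine summable_of_ne_finset_zero (s := {-⌊(rowRep v • w).re⌋}) fun n hn => ?_
      simp only [Finset.mem_singleton] at hn
      simp only [Equiv.sigmaEquivProd, Equiv.coe_fn_mk]
      rw [hzero v n hn, norm_zero]
    · have heq : ∀ v : gammaSet 1 1 0,
          ∑' n : ℤ, ‖((fun p : gammaSet 1 1 0 × ℤ => ‖F p‖) ∘ Equiv.sigmaEquivProd _ _) ⟨v, n⟩‖ = ‖Ψ (rowRep v • w)‖ := by
        intro v
        rw [tsum_eq_single (-⌊(rowRep v • w).re⌋) fun n hn => by
          simp only [Equiv.sigmaEquivProd, Equiv.coe_fn_mk, Function.comp_apply]; rw [hzero v n hn]; simp]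
        simp only [Equiv.sigmaEquivProd, Equiv.coe_fn_mk, Function.comp_apply, norm_norm]
        rw [hone v]
      refine hs.congr fun v => ?_
      have := heq v
      simp only [Equiv.sigmaEquivProd, Equiv.coe_fn_mk, Function.comp_apply, Real.norm_eq_abs, abs_norm] at this ⊢
      exact this.symm
  have hsumF : Summable F := hnorm.of_norm
  have h1 := hsumF.hasSum.prod_fiberwise hfib
  rw [h1.tsum_eq]
  exact hsumF.hasSum

/-- `SL₂(ℤ) ≃ 𝒮ℒ` (the image in `GL₂(ℝ)`). [folklore] -/
def slEquivModular : SL(2, ℤ) ≃ (𝒮ℒ : Subgroup (GL (Fin 2) ℝ)) :=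
  (MonoidHom.ofInjective (f := (Matrix.SpecialLinearGroup.mapGL ℝ : SL(2, ℤ) →* GL (Fin 2) ℝ))
    Matrix.SpecialLinearGroup.mapGL_injective).toEquiv

/-- Its action. [folklore] -/
theorem slEquivModular_smul (g : SL(2, ℤ)) (w : ℍ) : ((slEquivModular g : (𝒮ℒ : Subgroup (GL (Fin 2) ℝ))) : GL (Fin 2) ℝ) • w = g • w := rfl

/-- **Unfolding against an Eisenstein-type sum**: for `u` automorphic and `Ψ` `1`-periodic with
`𝟙_{S'} Ψ u ∈ L¹(ℍ)` and `Σ_v |Ψ(γ_v w)| < ∞` for all `w`,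
`∫_𝒟 u(w) Σ_{(c,d)=1} Ψ(γ_{c,d} w) dμ = 2 ∫_{S'} Ψ u dμ`. [cite: Iwaniec2002, §3.2 & (7.3)-(7.4) (unfolding), PDF pp. 42, 98] -/
theorem setIntegral_fd_mul_tsum_coset {u Ψ : ℍ → ℂ} (hua : IsAutomorphic (𝒮ℒ : Subgroup (GL (Fin 2) ℝ)) u)
    (hΨ : ∀ (n : ℤ) (w : ℍ), Ψ ((n : ℝ) +ᵥ w) = Ψ w)
    (hs : ∀ w : ℍ, Summable fun v : gammaSet 1 1 0 => ‖Ψ (rowRep v • w)‖)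
    (hint : Integrable fun w : ℍ => stripFD.indicator (fun _ => (1 : ℂ)) w * Ψ w * u w) :
    ∫ w in ModularGroup.fd, u w * ∑' v : gammaSet 1 1 0, Ψ (rowRep v • w) =
      2 * ∫ w in stripFD, Ψ w * u w := by
  have hΓ := modular_le_range_toGL
  have hneg := neg_one_mem_modular
  have hd := isDiscreteSubgroup_modular
  have hc := hd.countable
  have hF := isHypFundamentalDomain_modular_fd
  have h := setIntegral_tsum_smul_eq hΓ hneg hc hF hint
  have hpt : ∀ w : ℍ, ∑' γ : (𝒮ℒ : Subgroup (GL (Fin 2) ℝ)),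
      (fun w => stripFD.indicator (fun _ => (1 : ℂ)) w * Ψ w * u w) ((γ : GL (Fin 2) ℝ) • w) =
      u w * ∑' v : gammaSet 1 1 0, Ψ (rowRep v • w) := by
    intro w
    rw [← slEquivModular.tsum_eq]
    simp only [slEquivModular_smul]
    have hu : ∀ g : SL(2, ℤ), u (g • w) = u w := fun g => hua _ ⟨g, rfl⟩ w
    simp_rw [hu]
    rw [← (hasSum_indicator_stripFD_mul hΨ w (hs w)).tsum_eq, ← tsum_mul_left]
    congr 1 with g; ring
  simp_rw [hpt] at h
  rw [h, ← integral_indicator measurableSet_stripFD]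
  congr 1
  congr 1 with w
  by_cases hw : w ∈ stripFD <;> simp [hw]

end Coset

/-! ## Cusp forms are orthogonal to constants -/

section OrthConst

/-- `q ≥ 0` for `k ≥ 0`. [folklore] -/
theorem selbergQ_nonneg {k : ℝ → ℝ} (hk : ∀ u, 0 ≤ k u) (v : ℝ) : 0 ≤ selbergQ k v :=
  setIntegral_nonneg measurableSet_Ioi fun u _ => mul_nonneg (hk u) (Real.rpow_nonneg (by linarith [show v < u from ‹u ∈ Ioi v›]) _)

/-- `g ≥ 0` for `k ≥ 0`. [folklore] -/
theorem selbergG_nonneg {k : ℝ → ℝ} (hk : ∀ u, 0 ≤ k u) (r : ℝ) : 0 ≤ selbergG k r := by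
  unfold selbergG; exact mul_nonneg zero_le_two (selbergQ_nonneg hk _)

/-- The test-kernel data of `k₁`: measurable, `|k₁| ≤ 1`, `k₁ = 0` on `[2, ∞)`. [folklore] -/
theorem locKernel_data : Measurable locKernel ∧ (∀ u, |locKernel u| ≤ 1) ∧ ∀ u, (2 : ℝ) ≤ u → locKernel u = 0 :=
  ⟨isTestKernel_locKernel.1, fun u => by rw [abs_of_nonneg (locKernel_nonneg u)]; exact stKernel_le_one _ _ _,
    fun u hu => locKernel_eq_zero hu⟩

/-- `q_{k₁}(v) > 0` for `0 ≤ v < 1` (`k₁ = 1` on `[0,1]`). [folklore] -/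
theorem selbergQ_locKernel_pos {v : ℝ} (hv : v < 1) : 0 < selbergQ locKernel v := by
  obtain ⟨hm, hB, hM⟩ := locKernel_data
  have hint := integrableOn_selbergQ_integrand hm hB hM v
  unfold selbergQ
  rw [integral_pos_iff_support_of_nonneg_ae]
  · -- the support contains `(v, 1)`
    refine lt_of_lt_of_le ?_ (measure_mono (s := Ioo v 1) fun u hu => ?_)
    · rw [Measure.restrict_apply' measurableSet_Ioi, inter_eq_left.mpr Ioo_subset_Ioi_self, Real.volume_Ioo]
      exact ENNReal.ofReal_pos.mpr (by linarith)
    · simp only [Function.mem_support, ne_eq, mul_eq_zero, not_or]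
      refine ⟨by rw [locKernel_eq_one hu.2.le]; exact one_ne_zero, ?_⟩
      exact (Real.rpow_pos_of_pos (by linarith [hu.1]) _).ne'
  · filter_upwards [ae_restrict_mem measurableSet_Ioi] with u hu
    exact mul_nonneg (locKernel_nonneg u) (Real.rpow_nonneg (sub_nonneg.mpr (le_of_lt hu)) _)
  · exact hint

/-- `g_{k₁}(r) > 0` for `sinh²(r/2) < 1`. [folklore] -/
theorem selbergG_locKernel_pos {r : ℝ} (hr : Real.sinh (r / 2) ^ 2 < 1) : 0 < selbergG locKernel r := by
  unfold selbergG; exact mul_pos two_pos (selbergQ_locKernel_pos hr)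

/-- **`Re h_{k₁}(t) < h_{k₁}(i/2)` for real `t`**: `h(i/2) - Re h(t) = ∫ (e^{-r/2} - cos rt) g(r) dr =
∫_0^∞ 2(cosh(r/2) - cos rt) g(r) dr > 0`, as `g ≥ 0`, `g > 0` near `0`, `cosh > 1 ≥ cos` on `r > 0`.
[folklore] -/
theorem re_selbergTransform_lt (t : ℝ) :
    (selbergTransform locKernel t).re < 4 * π * ∫ u in Ioi 0, locKernel u := by
  obtain ⟨hm, hB, hM⟩ := locKernel_data
  have hI : ((4 * π * ∫ u in Ioi 0, locKernel u : ℝ) : ℂ) = selbergTransform locKernel (Complex.I / 2) :=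
    (selbergTransform_I_half isTestKernel_locKernel).symm
  -- real parts as real integrals
  have hreint : ∀ {φ : ℝ → ℂ} (hφ : Continuous φ),
      (∫ r, φ r * (selbergG locKernel r : ℂ)).re = ∫ r, (φ r).re * selbergG locKernel r := by
    intro φ hφ
    have hi := integrable_mul_selbergG_complex hm hB hM zero_le_two hφ
    rw [← Complex.reCLM_apply (∫ r, φ r * (selbergG locKernel r : ℂ)), ← ContinuousLinearMap.integral_comp_comm _ hi]
    congr 1 with r
    simp only [Complex.reCLM_apply, Complex.re_mul_ofReal]
  have hre : (selbergTransform locKernel t).re = ∫ r, Real.cos (r * t) * selbergG locKernel r := by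
    unfold selbergTransform
    rw [hreint (by fun_prop)]
    congr 1 with r
    have : Complex.exp (Complex.I * r * t) = Complex.exp ((r * t : ℝ) * Complex.I) := by push_cast; ring_nf
    rw [this, Complex.exp_ofReal_mul_I_re]
  have hhalf : 4 * π * ∫ u in Ioi 0, locKernel u = ∫ r, Real.exp (-(r / 2)) * selbergG locKernel r := by
    have h := congrArg Complex.re hI
    rw [Complex.ofReal_re] at h
    rw [h]
    unfold selbergTransform
    rw [hreint (by fun_prop)]
    congr 1 with r
    have : Complex.exp (Complex.I * r * (Complex.I / 2)) = Complex.exp ((-(r / 2) : ℝ)) := by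
      congr 1; push_cast; ring_nf; rw [Complex.I_sq]; ring
    rw [this, Complex.exp_ofReal_re]
  rw [hre, hhalf]
  have hi1 : Integrable fun r => Real.cos (r * t) * selbergG locKernel r := integrable_mul_selbergG hm hB hM zero_le_two (by fun_prop)
  have hi2 : Integrable fun r => Real.exp (-(r / 2)) * selbergG locKernel r :=
    integrable_mul_selbergG hm hB hM zero_le_two (by fun_prop)
  rw [← sub_pos, ← integral_sub hi2 hi1]
  -- `∫ (e^{-r/2} - cos rt) g = ∫_{r>0} (2cosh(r/2) - 2cos rt) g` by evenness; positivity on `(0, r₀)`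
  have heven : ∫ r, (Real.exp (-(r / 2)) * selbergG locKernel r - Real.cos (r * t) * selbergG locKernel r) =
      ∫ r in Ioi 0, (2 * Real.cosh (r / 2) - 2 * Real.cos (r * t)) * selbergG locKernel r := by
    have hA := integral_exp_mul_selbergG hm hB hM zero_le_two
    have hB' : ∫ r, Real.cos (r * t) * selbergG locKernel r = ∫ r in Ioi 0, 2 * Real.cos (r * t) * selbergG locKernel r := by
      rw [← setIntegral_univ, ← Iic_union_Ioi (a := (0 : ℝ)),
        setIntegral_union (Iic_disjoint_Ioi le_rfl) measurableSet_Ioi hi1.integrableOn hi1.integrableOn]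
      have h1 : ∫ r in Iic 0, Real.cos (r * t) * selbergG locKernel r = ∫ r in Ioi 0, Real.cos (r * t) * selbergG locKernel r := by
        rw [show Iic (0 : ℝ) = Iic (-0) by rw [neg_zero], ← integral_comp_neg_Ioi]
        congr 1 with r
        rw [selbergG_neg, neg_mul, Real.cos_neg]
      rw [h1, ← two_mul, ← integral_const_mul]
      congr 1 with r; ring
    rw [integral_sub hi2 hi1, hA, hB', ← integral_sub]
    · congr 1 with r; ring
    · exact (integrable_mul_selbergG hm hB hM zero_le_two (by fun_prop)).integrableOn
    · exact (integrable_mul_selbergG hm hB hM zero_le_two (by fun_prop)).integrableOn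
  rw [heven, integral_pos_iff_support_of_nonneg_ae]
  · -- support ⊇ (0, r₀) with sinh²(r₀/2) < 1, e.g. r₀ = 1
    have hsinh : ∀ r ∈ Ioo (0 : ℝ) 1, Real.sinh (r / 2) ^ 2 < 1 := by
      intro r hr
      have h1 : Real.sinh (r / 2) < Real.sinh (1 / 2) := Real.sinh_strictMono (by linarith [hr.2])
      have h2 : Real.sinh (1 / 2) < 1 := by
        rw [Real.sinh_eq]
        have hsq : Real.exp (1 / 2) ^ 2 = Real.exp 1 := by rw [← Real.exp_nat_mul]; norm_num
        have he : Real.exp 1 < 2.7182818286 := Real.exp_one_lt_d9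
        have hpos : 0 < Real.exp (1 / 2) := Real.exp_pos _
        have hx : Real.exp (1 / 2) < 2 := by nlinarith
        have hneg : 0 < Real.exp (-(1 / 2)) := Real.exp_pos _
        linarith
      have h0 : 0 < Real.sinh (r / 2) := Real.sinh_pos_iff.mpr (by linarith [hr.1])
      nlinarith
    refine lt_of_lt_of_le ?_ (measure_mono (s := Ioo (0 : ℝ) 1) fun r hr => ?_)
    · rw [Measure.restrict_apply' measurableSet_Ioi, inter_eq_left.mpr Ioo_subset_Ioi_self, Real.volume_Ioo]
      norm_num
    · simp only [Function.mem_support, ne_eq, mul_eq_zero, not_or]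
      refine ⟨?_, (selbergG_locKernel_pos (hsinh r hr)).ne'⟩
      have hc : Real.cos (r * t) ≤ 1 := Real.cos_le_one _
      have hch : 1 < Real.cosh (r / 2) := Real.one_lt_cosh.mpr (by linarith [hr.1])
      linarith
  · filter_upwards [ae_restrict_mem measurableSet_Ioi] with r hr
    have hc : Real.cos (r * t) ≤ 1 := Real.cos_le_one _
    have hch : 1 ≤ Real.cosh (r / 2) := Real.one_le_cosh _
    exact mul_nonneg (by linarith) (selbergG_nonneg locKernel_nonneg r)
  · exact (integrable_mul_selbergG hm hB hM zero_le_two (by fun_prop)).integrableOn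

open scoped InnerProductSpace in
/-- **Maass cusp forms are orthogonal to constants**: `∫_𝒟 u dμ = 0` (the constant is the
eigenfunction of `T_{k₁}` with eigenvalue `h(i/2) > Re h(t)`, and `T_{k₁}` is symmetric).
[cite: Iwaniec2002, §4.1–4.2 & §7.2, PDF pp. 48–49, 73] -/
theorem IsMaassCuspForm.setIntegral_fd_eq_zero {u : ℍ → ℂ} {t : ℂ} (h : IsMaassCuspForm u t)
    (hL2 : IntegrableOn (fun z => ‖u z‖ ^ 2) ModularGroup.fd) (ht : t.im = 0) :
    ∫ z in ModularGroup.fd, u z = 0 := by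
  have hΓ := modular_le_range_toGL
  have hneg := neg_one_mem_modular
  have hd := isDiscreteSubgroup_modular
  have hF := isHypFundamentalDomain_modular_fd
  have hk := isTestKernel_locKernel
  have hkc : Continuous locKernel := (contDiff_locKernel (n := 0)).continuous
  haveI : IsFiniteMeasure (volume.restrict ModularGroup.fd) := isFiniteMeasure_restrict_fd
  have hu2 : MemLp u 2 (volume.restrict ModularGroup.fd) :=
    (memLp_two_iff_integrable_sq_norm h.continuous.aestronglyMeasurable.restrict).mpr hL2
  have hc2 : MemLp (fun _ : ℍ => (1 : ℂ)) 2 (volume.restrict ModularGroup.fd) := memLp_const 1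
  set T := kernelCLM hΓ hneg hd hF hk hkc with hT
  have hTu : T (hu2.toLp u) = selbergTransform locKernel t • hu2.toLp u :=
    kernelCLM_toLp_eigenfunction hΓ hneg hd hF hk hkc h.automorphic h.isC2 t h.eigen hu2
  have hTc : T (hc2.toLp fun _ => 1) = (((4 * π * ∫ v in Ioi 0, locKernel v : ℝ) : ℂ)) • hc2.toLp fun _ => 1 :=
    kernelCLM_toLp_const hΓ hneg hd hF hk hkc 1 hc2
  have hsym := kernelCLM_isSymmetric hΓ hneg hd hF hk hkc (hu2.toLp u) (hc2.toLp fun _ => 1)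
  change ⟪T (hu2.toLp u), hc2.toLp fun _ => 1⟫_ℂ = ⟪hu2.toLp u, T (hc2.toLp fun _ => 1)⟫_ℂ at hsym
  rw [hTu, hTc, inner_smul_left, inner_smul_right] at hsym
  -- the two eigenvalues differ
  have hne : (starRingEnd ℂ) (selbergTransform locKernel t) ≠ ((4 * π * ∫ v in Ioi 0, locKernel v : ℝ) : ℂ) := by
    intro heq
    have := congrArg Complex.re heq
    rw [Complex.conj_re, Complex.ofReal_re] at this
    have ht' : t = (t.re : ℂ) := by apply Complex.ext <;> simp [ht]
    have hlt := re_selbergTransform_lt t.re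
    rw [← ht'] at hlt
    linarith
  have hinner : ⟪hu2.toLp u, hc2.toLp fun _ => (1 : ℂ)⟫_ℂ = 0 := by
    have : ((starRingEnd ℂ) (selbergTransform locKernel t) - ((4 * π * ∫ v in Ioi 0, locKernel v : ℝ) : ℂ)) *
        ⟪hu2.toLp u, hc2.toLp fun _ => (1 : ℂ)⟫_ℂ = 0 := by rw [sub_mul, hsym, sub_self]
    exact (mul_eq_zero.mp this).resolve_left (sub_ne_zero.mpr hne)
  -- read the inner product as `∫_𝒟 conj u`
  rw [MeasureTheory.L2.inner_def] at hinner
  have hae : (fun z => ⟪(hu2.toLp u) z, (hc2.toLp fun _ => (1 : ℂ)) z⟫_ℂ) =ᵐ[volume.restrict ModularGroup.fd]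
      fun z => (starRingEnd ℂ) (u z) := by
    filter_upwards [hu2.coeFn_toLp, hc2.coeFn_toLp] with z hz hc
    rw [hz, hc]
    simp
  rw [integral_congr_ae hae, integral_conj] at hinner
  exact (map_eq_zero (starRingEnd ℂ)).mp hinner

end OrthConst

/-! ## Tonelli on `ℍ` and on the strip `S'` (Lebesgue integrals) -/

section Tonelli

/-- A measurable left inverse of the inclusion `ℍ → ℂ` (agrees with `ofComplex` on `{Im > 0}`). [folklore] -/
def invCoe : ℂ → ℍ := measurableEmbedding_coe.invFun

/-- `invCoe` is measurable. [folklore] -/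
theorem measurable_invCoe : Measurable invCoe := measurableEmbedding_coe.measurable_invFun

/-- `invCoe ↑w = w`. [folklore] -/
theorem invCoe_coe (w : ℍ) : invCoe (w : ℂ) = w := measurableEmbedding_coe.leftInverse_invFun w

/-- `invCoe (x + iy) = pt x y` for `y > 0`. [folklore] -/
theorem invCoe_mk {x y : ℝ} (hy : 0 < y) : invCoe ⟨x, y⟩ = pt x y := by
  rw [pt_eq hy, ← invCoe_coe ⟨⟨x, y⟩, hy⟩]

/-- **The hyperbolic Lebesgue integral in Euclidean coordinates**:
`∫⁻_ℍ f dμ = ∫⁻_{Im z > 0} y⁻² f(z) dA`. [cite: Iwaniec2002, (1.8), PDF p. 10] -/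
theorem lintegral_upperHalfPlane_eq (f : ℍ → ℝ≥0∞) (hf : Measurable f) :
    ∫⁻ w, f w = ∫⁻ z in {z : ℂ | 0 < z.im}, ENNReal.ofReal ((z.im ^ 2)⁻¹) * f (invCoe z) := by
  rw [UpperHalfPlane.volume_def, lintegral_withDensity_eq_lintegral_mul _ (measurable_hypDensity.coe_nnreal_ennreal) hf]
  set g : ℂ → ℝ≥0∞ := fun z => ENNReal.ofReal ((z.im ^ 2)⁻¹) * f (invCoe z) with hg
  have e1 : ((fun w : ℍ => (((1 / NNReal.mk w.im w.im_pos.le) ^ 2 : ℝ≥0) : ℝ≥0∞)) * f) = fun w : ℍ => g (w : ℂ) := by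
    funext w
    simp only [Pi.mul_apply, hg, invCoe_coe]
    congr 1
    rw [ENNReal.ofReal, ENNReal.coe_inj]
    apply NNReal.eq
    rw [Real.coe_toNNReal _ (by positivity)]
    simp [NNReal.coe_pow]
  rw [e1, ← measurableEmbedding_coe.lintegral_map, measurableEmbedding_coe.map_comap,
    _root_.UpperHalfPlane.range_coe]

/-- Tonelli over the upper half-plane, `y` outside: `∫⁻_{Im z>0} g dA = ∫⁻_0^∞ ∫⁻_ℝ g(x + iy) dx dy`. [folklore] -/
theorem setLIntegral_upperHalf_eq_iterated (g : ℂ → ℝ≥0∞) (hg : Measurable g) :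
    ∫⁻ z in {z : ℂ | 0 < z.im}, g z = ∫⁻ y in Ioi (0 : ℝ), ∫⁻ x : ℝ, g ⟨x, y⟩ := by
  have hmp := Complex.volume_preserving_equiv_real_prod
  have hme := Complex.measurableEquivRealProd.measurableEmbedding
  set G : ℝ × ℝ → ℝ≥0∞ := fun p => g ⟨p.1, p.2⟩ with hG
  have hGe : G = g ∘ Complex.measurableEquivRealProd.symm := by
    funext p; simp only [hG, Function.comp_apply, Complex.measurableEquivRealProd_symm_apply]
  have hGm : Measurable G := by rw [hGe]; exact hg.comp Complex.measurableEquivRealProd.symm.measurable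
  have h1 : ∫⁻ z in {z : ℂ | 0 < z.im}, g z = ∫⁻ p in univ ×ˢ Ioi (0 : ℝ), G p ∂(volume.prod volume) := by
    rw [upperHalf_eq_preimage, ← Measure.volume_eq_prod, ← hmp.setLIntegral_comp_preimage_emb hme]
    rfl
  rw [h1, ← Measure.prod_restrict, Measure.restrict_univ, lintegral_prod_symm _ hGm.aemeasurable]

/-- **Tonelli on the strip**: `∫⁻_{S'} F dμ = ∫⁻_0^∞ (∫⁻_{[0,1)} F(x + iy) dx) y⁻² dy` for
measurable `F ≥ 0`. [folklore] -/
theorem setLIntegral_stripFD_eq (F : ℍ → ℝ≥0∞) (hF : Measurable F) :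
    ∫⁻ w in stripFD, F w = ∫⁻ y in Ioi (0 : ℝ), (∫⁻ x in Ico (0 : ℝ) 1, F (pt x y)) * ENNReal.ofReal ((y ^ 2)⁻¹) := by
  have hmeas : Measurable fun z : ℂ => ENNReal.ofReal ((z.im ^ 2)⁻¹) * (stripFD.indicator F) (invCoe z) :=
    (ENNReal.measurable_ofReal.comp ((Complex.measurable_im.pow_const 2).inv)).mul
      ((hF.indicator measurableSet_stripFD).comp measurable_invCoe)
  rw [← lintegral_indicator measurableSet_stripFD,
    lintegral_upperHalfPlane_eq _ (hF.indicator measurableSet_stripFD),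
    setLIntegral_upperHalf_eq_iterated _ hmeas]
  refine setLIntegral_congr_fun measurableSet_Ioi fun y hy => ?_
  have hy' : (0 : ℝ) < y := hy
  have hmx : Measurable fun x : ℝ => (Ico (0 : ℝ) 1).indicator (fun x => F (pt x y)) x :=
    (hF.comp (continuous_pt hy').measurable).indicator measurableSet_Ico
  rw [← lintegral_indicator measurableSet_Ico, ← lintegral_mul_const _ hmx]
  congr 1 with x
  rw [invCoe_mk hy']
  simp only [Set.indicator]
  have hiff : pt x y ∈ stripFD ↔ x ∈ Ico (0 : ℝ) 1 := by
    simp only [stripFD, mem_setOf_eq, pt_re hy', mem_Ico]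
  by_cases hx : x ∈ Ico (0 : ℝ) 1
  · rw [if_pos (hiff.mpr hx), if_pos hx, mul_comm]
  · rw [if_neg (fun h => hx (hiff.mp h)), if_neg hx, mul_zero, zero_mul]

end Tonelli

/-! ## Unfolding coset sums of non-negative functions (Lebesgue integrals) -/

section CosetLIntegral

open EisensteinSeries ModularGroup

/-- The coset-to-matrix identity for `ℝ≥0∞`-valued `1`-periodic `Ψ`. [folklore] -/
theorem tsum_indicator_stripFD_mul_ennreal {Ψ : ℍ → ℝ≥0∞} (hΨ : ∀ (n : ℤ) (w : ℍ), Ψ ((n : ℝ) +ᵥ w) = Ψ w) (w : ℍ) :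
    ∑' g : SL(2, ℤ), stripFD.indicator (fun _ => (1 : ℝ≥0∞)) (g • w) * Ψ (g • w) =
      ∑' v : gammaSet 1 1 0, Ψ (rowRep v • w) := by
  rw [← cosetEquiv.symm.tsum_eq]
  simp only [cosetEquiv_symm_smul, hΨ]
  rw [ENNReal.tsum_prod']
  congr 1 with v
  rw [tsum_eq_single (-⌊(rowRep v • w).re⌋)]
  · rw [Set.indicator_of_mem ((int_vadd_mem_stripFD_iff _ _).mpr rfl), one_mul]
  · intro n hn
    rw [Set.indicator_of_notMem (fun h => hn ((int_vadd_mem_stripFD_iff _ n).mp h)), zero_mul]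

/-- **Unfolding a coset sum against an automorphic non-negative function**:
`∫⁻_𝒟 Φ(w) Σ_{(c,d)=1} Ψ(γ_{c,d} w) dμ = 2 ∫⁻_{S'} Ψ Φ dμ`. [cite: Iwaniec2002, §3.2 & (7.4), PDF pp. 42, 98] -/
theorem setLIntegral_fd_mul_tsum_coset {Φ Ψ : ℍ → ℝ≥0∞} (hΦm : Measurable Φ) (hΨm : Measurable Ψ)
    (hΦa : ∀ γ ∈ (𝒮ℒ : Subgroup (GL (Fin 2) ℝ)), ∀ w : ℍ, Φ (γ • w) = Φ w)
    (hΨ : ∀ (n : ℤ) (w : ℍ), Ψ ((n : ℝ) +ᵥ w) = Ψ w) :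
    ∫⁻ w in ModularGroup.fd, Φ w * ∑' v : gammaSet 1 1 0, Ψ (rowRep v • w) = 2 * ∫⁻ w in stripFD, Ψ w * Φ w := by
  have hΓ := modular_le_range_toGL
  have hneg := neg_one_mem_modular
  have hd := isDiscreteSubgroup_modular
  have hc := hd.countable
  have hF := isHypFundamentalDomain_modular_fd
  set φ : ℍ → ℝ≥0∞ := fun w => stripFD.indicator (fun _ => (1 : ℝ≥0∞)) w * Ψ w * Φ w with hφ
  have hφm : AEMeasurable φ := (((measurable_const.indicator measurableSet_stripFD).mul hΨm).mul hΦm).aemeasurable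
  have h := setLIntegral_tsum_smul_eq hΓ hneg hc hF hφm
  have hpt : ∀ w : ℍ, ∑' γ : (𝒮ℒ : Subgroup (GL (Fin 2) ℝ)), φ ((γ : GL (Fin 2) ℝ) • w) =
      Φ w * ∑' v : gammaSet 1 1 0, Ψ (rowRep v • w) := by
    intro w
    rw [← slEquivModular.tsum_eq]
    simp only [slEquivModular_smul, hφ]
    have hu : ∀ g : SL(2, ℤ), Φ (g • w) = Φ w := fun g => hΦa _ ⟨g, rfl⟩ w
    simp_rw [hu]
    rw [← tsum_indicator_stripFD_mul_ennreal hΨ w, ← ENNReal.tsum_mul_left]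
    congr 1 with g; ring
  simp_rw [hpt] at h
  rw [h, ← lintegral_indicator measurableSet_stripFD]
  congr 1
  congr 1 with w
  by_cases hw : w ∈ stripFD <;> simp [hφ, hw]

end CosetLIntegral

/-! ## `Θ_z(t) - 1` as a sum over cosets -/

section ThetaCoset

open EisensteinSeries ModularGroup

/-- `Q_z(r v) = r² Q_z(v)`. [folklore] -/
theorem qForm_nsmul (z : ℍ) (r : ℕ) (w : Fin 2 → ℤ) : qForm z (r • w) = (r : ℝ) ^ 2 * qForm z w := by
  simp only [qForm, Pi.smul_apply, nsmul_eq_mul, Int.cast_mul, Int.cast_natCast]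
  rw [show ((r : ℂ)) * (w 0 : ℂ) * z + (r : ℂ) * (w 1 : ℂ) = (r : ℂ) * ((w 0 : ℂ) * z + w 1) by ring,
    norm_mul, Complex.norm_natCast]
  ring

/-- For a coprime pair, `Q_z(c, d) = 1 / Im(γ_{c,d} z)`. [folklore] -/
theorem qForm_eq_inv_im (z : ℍ) (w : gammaSet 1 1 0) : qForm z w = ((rowRep w • z).im)⁻¹ := by
  rw [ModularGroup.im_smul_eq_div_normSq, Complex.normSq_eq_norm_sq, ModularGroup.denom_apply, (rowRep_spec w).1,
    (rowRep_spec w).2, qForm, inv_div]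

variable (z : ℍ) (t : ℝ)

/-- **`Θ_z(t) - 1` sorted by the gcd**: `Σ_{v ≠ 0} e^{-πtQ_z(v)} = Σ_{r ≥ 1} Σ_{(c,d)=1} e^{-πtr²/Im(γ_{c,d}z)}`
(as a sum in `[0, ∞]`). [cite: Iwaniec2002, (3.27) (sorting by the gcd), PDF p. 47] -/
theorem tsum_thetaTerm_eq_tsum_coset :
    ∑' v : Fin 2 → ℤ, (if v = 0 then 0 else ENNReal.ofReal (Real.exp (-π * t * qForm z v))) =
      ∑' r : ℕ, ∑' w : gammaSet 1 1 0, ENNReal.ofReal (Real.exp (-π * t * ((r : ℝ) + 1) ^ 2 / (rowRep w • z).im)) := by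
  set g : (Fin 2 → ℤ) → ℝ≥0∞ := fun v => if v = 0 then 0 else ENNReal.ofReal (Real.exp (-π * t * qForm z v)) with hg
  rw [← gammaSetDivGcdSigmaEquiv.symm.tsum_eq]
  simp only [gammaSetDivGcdSigmaEquiv_symm_eq]
  rw [ENNReal.tsum_sigma']
  rw [tsum_eq_zero_add' ENNReal.summable]
  -- `r = 0`: only `v = 0`
  have h0 : ∑' v : gammaSet 1 0 0, g v = 0 := by
    refine ENNReal.tsum_eq_zero.mpr fun v => ?_
    have hv : (v : Fin 2 → ℤ) = 0 := by
      have := gammaSet_eq_gcd_mul_divIntMap v.2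
      simpa using this
    simp [hg, hv]
  rw [h0, zero_add]
  congr 1 with n
  haveI : NeZero (n + 1) := ⟨Nat.succ_ne_zero n⟩
  rw [← (gammaSetDivGcdEquiv (n + 1)).symm.tsum_eq]
  congr 1 with w
  set v := (gammaSetDivGcdEquiv (n + 1)).symm w with hv
  have h2 : divIntMap ((n + 1 : ℕ) : ℤ) v.1 = w := by
    have := gammaSetDivGcdEquiv_eq (n + 1) v
    rw [hv, Equiv.apply_symm_apply] at this
    rw [hv]; exact this.symm
  have hvw : (v : Fin 2 → ℤ) = (n + 1 : ℕ) • (w : Fin 2 → ℤ) := by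
    have h1 := gammaSet_eq_gcd_mul_divIntMap v.2
    rw [h2] at h1
    exact h1
  have hne : (v : Fin 2 → ℤ) ≠ 0 := by
    intro h
    have hw := (mem_gammaSet_one _).mp w.2
    have hw0 : (w : Fin 2 → ℤ) = 0 := by
      funext i
      have hi := congrFun hvw i
      rw [h] at hi
      simp only [Pi.zero_apply, Pi.smul_apply, nsmul_eq_mul] at hi
      rcases mul_eq_zero.mp hi.symm with h' | h'
      · exact absurd h' (by exact_mod_cast Nat.succ_ne_zero n)
      · exact h'
    rw [hw0] at hw
    exact not_isUnit_zero (isCoprime_zero_left.mp hw)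
  show g ((⟨n + 1, v⟩ : Σ r : ℕ, gammaSet 1 r 0).snd) = _
  simp only [hg]
  rw [if_neg hne, hvw, qForm_nsmul, qForm_eq_inv_im]
  congr 2
  push_cast
  ring

/-- `Θ_z(t) - 1 = Σ_{v ≠ 0} e^{-πtQ_z(v)}` in `[0, ∞]`. [folklore] -/
theorem ofReal_thetaQ_sub_one (ht : 0 < t) :
    ENNReal.ofReal (thetaQ z t - 1) = ∑' v : Fin 2 → ℤ, (if v = 0 then 0 else ENNReal.ofReal (Real.exp (-π * t * qForm z v))) := by
  have hs := summable_exp_qForm z ht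
  have h0 : Real.exp (-π * t * qForm z 0) = 1 := by simp [qForm]
  have hsplit := hs.tsum_eq_add_tsum_ite 0
  unfold thetaQ
  rw [hsplit, h0, add_sub_cancel_left, ENNReal.ofReal_tsum_of_nonneg]
  · congr 1 with v
    by_cases hv : v = 0
    · simp [hv]
    · simp [hv]
  · intro v; by_cases hv : v = 0 <;> simp [hv, (Real.exp_pos _).le]
  · have e : (fun n : Fin 2 → ℤ => if n = 0 then 0 else Real.exp (-π * t * qForm z n)) =
        Function.update (fun v => Real.exp (-π * t * qForm z v)) 0 0 := by
      funext n; simp only [Function.update_apply]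
    rw [e]; exact hs.update 0 0

/-- `∫_0^∞ e^{-a/y} y⁻² dy = 1/a` (`a > 0`; an antiderivative is `e^{-a/y}/a`). [folklore] -/
theorem integral_exp_neg_div_mul_inv_sq {a : ℝ} (ha : 0 < a) :
    IntegrableOn (fun y : ℝ => Real.exp (-a / y) * (y ^ 2)⁻¹) (Ioi 0) ∧
      ∫ y in Ioi (0 : ℝ), Real.exp (-a / y) * (y ^ 2)⁻¹ = 1 / a := by
  set F : ℝ → ℝ := fun y => if 0 < y then Real.exp (-a / y) / a else 0 with hF
  have hFpos : ∀ {y : ℝ}, 0 < y → F y = Real.exp (-a / y) / a := fun hy => by simp only [hF]; rw [if_pos hy]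
  have hderiv : ∀ y ∈ Ioi (0 : ℝ), HasDerivAt F (Real.exp (-a / y) * (y ^ 2)⁻¹) y := by
    intro y hy
    have hy' : (0 : ℝ) < y := hy
    have hin : HasDerivAt (fun y : ℝ => -a / y) (a / y ^ 2) y := by
      have h := (hasDerivAt_inv hy'.ne').const_mul (-a)
      have e : (fun y : ℝ => -a * y⁻¹) = fun y => -a / y := funext fun v => by rw [div_eq_mul_inv]
      rw [e] at h
      refine h.congr_deriv ?_
      rw [div_eq_mul_inv]; ring
    have h1 : HasDerivAt (fun y : ℝ => Real.exp (-a / y) / a) (Real.exp (-a / y) * (y ^ 2)⁻¹) y := by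
      refine ((hin.exp).div_const a).congr_deriv ?_
      have ha' : a ≠ 0 := ha.ne'
      field_simp
    refine h1.congr_of_eventuallyEq ?_
    filter_upwards [isOpen_Ioi.mem_nhds hy] with v hv
    exact hFpos hv
  have hpos : ∀ y ∈ Ioi (0 : ℝ), 0 ≤ Real.exp (-a / y) * (y ^ 2)⁻¹ := fun y _ => by positivity
  have hlim : Tendsto F atTop (𝓝 (1 / a)) := by
    have h1 : Tendsto (fun y : ℝ => Real.exp (-a / y) / a) atTop (𝓝 (Real.exp 0 / a)) := by
      refine ((Real.continuous_exp.tendsto 0).comp ?_).div_const a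
      simpa using (tendsto_const_nhds (x := -a)).div_atTop tendsto_id
    rw [Real.exp_zero] at h1
    refine h1.congr' ?_
    filter_upwards [eventually_gt_atTop 0] with y hy
    exact (hFpos hy).symm
  have hcont : ContinuousWithinAt F (Ici 0) 0 := by
    have h0 : F 0 = 0 := by simp [hF]
    rw [ContinuousWithinAt, h0]
    have h1 : Tendsto (fun y : ℝ => Real.exp (-a / y) / a) (𝓝[>] 0) (𝓝 0) := by
      have hneg : Tendsto (fun y : ℝ => -a / y) (𝓝[>] 0) atBot := by
        have h := (Tendsto.const_mul_atTop ha tendsto_inv_nhdsGT_zero)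
        have h' : Tendsto (fun y : ℝ => -(a * y⁻¹)) (𝓝[>] 0) atBot := tendsto_neg_atTop_atBot.comp h
        refine h'.congr fun y => ?_
        rw [div_eq_mul_inv]; ring
      have := (Real.tendsto_exp_atBot.comp hneg).div_const a
      simpa using this
    have h2 : Tendsto F (𝓝[>] 0) (𝓝 0) := by
      refine h1.congr' ?_
      filter_upwards [self_mem_nhdsWithin] with y hy
      exact (hFpos hy).symm
    rw [← Ioi_insert, nhdsWithin_insert, tendsto_sup]
    refine ⟨?_, h2⟩
    have h3 : Tendsto F (pure 0) (𝓝 (F 0)) := tendsto_pure_nhds F 0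
    rwa [h0] at h3
  refine ⟨integrableOn_Ioi_deriv_of_nonneg hcont hderiv hpos hlim, ?_⟩
  rw [integral_Ioi_of_hasDerivAt_of_nonneg hcont hderiv hpos hlim]
  simp [hF]

/-- **The mass of `Θ - 1` on the fundamental domain**: `∫_𝒟 (Θ_z(t) - 1) dμ(z) = π/(3t)`
(unfold each gcd-class onto the strip: `Σ_{r≥1} 2∫_0^∞ e^{-πtr²/y} y⁻² dy = Σ_r 2/(πtr²) = π/(3t)`).
[cite: Iwaniec2002, §3.2 (unfolding) & (3.26)–(3.27), PDF pp. 42, 47] -/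
theorem lintegral_fd_thetaQ_sub_one {t : ℝ} (ht : 0 < t) :
    ∫⁻ z in ModularGroup.fd, ENNReal.ofReal (thetaQ z t - 1) = ENNReal.ofReal (π / (3 * t)) := by
  have e1 : ∀ z : ℍ, ENNReal.ofReal (thetaQ z t - 1) =
      ∑' r : ℕ, ∑' w : gammaSet 1 1 0, ENNReal.ofReal (Real.exp (-π * t * ((r : ℝ) + 1) ^ 2 / (rowRep w • z).im)) := fun z => by
    rw [ofReal_thetaQ_sub_one z t ht, tsum_thetaTerm_eq_tsum_coset z t]
  simp_rw [e1]
  set G : ℕ → ℍ → ℝ≥0∞ := fun r ζ => ENNReal.ofReal (Real.exp (-π * t * ((r : ℝ) + 1) ^ 2 / ζ.im)) with hG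
  have hGm : ∀ r, Measurable (G r) := fun r =>
    ENNReal.measurable_ofReal.comp (Real.continuous_exp.measurable.comp
      (measurable_const.div UpperHalfPlane.continuous_im.measurable))
  have hGper : ∀ r (n : ℤ) (w : ℍ), G r ((n : ℝ) +ᵥ w) = G r w := fun r n w => by simp only [hG, vadd_im]
  -- measurability of the coset sums
  haveI : Countable (gammaSet 1 1 0) := Set.Countable.to_subtype (Set.to_countable _)
  have hsm : ∀ r, Measurable fun z : ℍ => ∑' w : gammaSet 1 1 0, G r (rowRep w • z) := fun r =>
    Measurable.tsum fun w => (hGm r).comp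
      (continuous_const_smul (Matrix.SpecialLinearGroup.mapGL ℝ (rowRep w) : GL (Fin 2) ℝ)).measurable
  rw [lintegral_tsum fun r => (hsm r).aemeasurable]
  -- each gcd-class unfolds onto the strip
  have hclass : ∀ r : ℕ, ∫⁻ z in ModularGroup.fd, ∑' w : gammaSet 1 1 0, G r (rowRep w • z) =
      2 * ENNReal.ofReal (1 / (π * t * ((r : ℝ) + 1) ^ 2)) := by
    intro r
    have ha : 0 < π * t * ((r : ℝ) + 1) ^ 2 := by positivity
    have h1 := setLIntegral_fd_mul_tsum_coset (Φ := fun _ => (1 : ℝ≥0∞)) (Ψ := G r) measurable_const (hGm r)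
      (fun _ _ _ => rfl) (hGper r)
    simp only [one_mul, mul_one] at h1
    rw [h1, setLIntegral_stripFD_eq _ (hGm r)]
    congr 1
    have hfib : ∀ y ∈ Ioi (0 : ℝ), (∫⁻ x in Ico (0 : ℝ) 1, G r (pt x y)) * ENNReal.ofReal ((y ^ 2)⁻¹) =
        ENNReal.ofReal (Real.exp (-(π * t * ((r : ℝ) + 1) ^ 2) / y) * (y ^ 2)⁻¹) := by
      intro y hy
      have hy' : (0 : ℝ) < y := hy
      have : ∀ x : ℝ, G r (pt x y) = ENNReal.ofReal (Real.exp (-(π * t * ((r : ℝ) + 1) ^ 2) / y)) := fun x => by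
        simp only [hG, pt_im hy']; congr 2; ring
      simp_rw [this]
      rw [setLIntegral_const, Real.volume_Ico, sub_zero, ENNReal.ofReal_one, mul_one,
        ← ENNReal.ofReal_mul (Real.exp_pos _).le]
    rw [setLIntegral_congr_fun measurableSet_Ioi hfib]
    obtain ⟨hint, hval⟩ := integral_exp_neg_div_mul_inv_sq ha
    rw [← ofReal_integral_eq_lintegral_ofReal hint (Eventually.of_forall fun y => by positivity), hval]
  simp_rw [hclass]
  -- sum the series: `Σ_r 2/(πt(r+1)²) = π/(3t)`
  have hz : HasSum (fun r : ℕ => 1 / (π * t * ((r : ℝ) + 1) ^ 2)) (1 / (π * t) * (π ^ 2 / 6)) := by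
    have h := (hasSum_nat_add_iff' 1).mpr hasSum_zeta_two
    simp only [Finset.range_one, Finset.sum_singleton, Nat.cast_zero, ne_eq, OfNat.ofNat_ne_zero,
      not_false_eq_true, zero_pow, div_zero, sub_zero] at h
    have h' := h.mul_left (1 / (π * t))
    have e : (fun r : ℕ => 1 / (π * t * ((r : ℝ) + 1) ^ 2)) = fun i : ℕ => 1 / (π * t) * (1 / ((i + 1 : ℕ) : ℝ) ^ 2) := by
      funext r; push_cast; field_simp
    rw [e]; exact h'
  rw [ENNReal.tsum_mul_left, ← ENNReal.ofReal_ofNat 2, ← ENNReal.ofReal_tsum_of_nonneg (fun r => by positivity) hz.summable,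
    ← ENNReal.ofReal_mul zero_le_two, hz.tsum_eq]
  congr 1
  field_simp
  ring

/-- **Fubini on the strip (Bochner)**: `∫_{S'} F dμ = ∫_0^∞ (∫_{[0,1)} F(x+iy) dx) y⁻² dy` for `F`
integrable on `S'`. [folklore] -/
theorem setIntegral_stripFD_eq {F : ℍ → ℂ} (hF : IntegrableOn F stripFD) :
    ∫ w in stripFD, F w = ∫ y in Ioi (0 : ℝ), ((y ^ 2)⁻¹ : ℝ) • ∫ x in Ico (0 : ℝ) 1, F (pt x y) := by
  rw [← integral_indicator measurableSet_stripFD]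
  set Φ' : ℍ → ℂ := stripFD.indicator F with hΦ'
  have hΦ'i : Integrable Φ' := hF.integrable_indicator measurableSet_stripFD
  set g : ℂ → ℂ := fun q => ((q.im ^ 2)⁻¹ : ℝ) • Φ' (ofComplex q) with hg
  have hgi : IntegrableOn g {q : ℂ | 0 < q.im} := (integrable_upperHalfPlane_iff_integrableOn_complex Φ').mp hΦ'i
  rw [integral_upperHalfPlane_eq_integral_complex, setIntegral_upperHalf_eq_iterated g hgi]
  refine setIntegral_congr_fun measurableSet_Ioi fun y hy => ?_
  have hy' : (0 : ℝ) < y := hy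
  rw [← integral_smul, ← integral_indicator measurableSet_Ico]
  congr 1 with x
  simp only [hg, hΦ']
  rw [show (ofComplex (⟨x, y⟩ : ℂ) : ℍ) = pt x y from rfl]
  have hiff : pt x y ∈ stripFD ↔ x ∈ Ico (0 : ℝ) 1 := by
    simp only [stripFD, mem_setOf_eq, pt_re hy', mem_Ico]
  by_cases hx : x ∈ Ico (0 : ℝ) 1
  · rw [Set.indicator_of_mem (hiff.mpr hx), Set.indicator_of_mem hx]
  · rw [Set.indicator_of_notMem (fun h => hx (hiff.mp h)), Set.indicator_of_notMem hx, smul_zero]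

/-- The coset sums of `e^{-πtr²/Im}` as real numbers: summable, with the value read off from
`Θ_z(t) - 1`. [folklore] -/
theorem summable_coset_exp (z : ℍ) {t : ℝ} (ht : 0 < t) (r : ℕ) :
    Summable fun w : gammaSet 1 1 0 => Real.exp (-π * t * ((r : ℝ) + 1) ^ 2 / (rowRep w • z).im) := by
  -- a subseries of the absolutely convergent theta series
  have hfin : ∑' w : gammaSet 1 1 0, ENNReal.ofReal (Real.exp (-π * t * ((r : ℝ) + 1) ^ 2 / (rowRep w • z).im)) ≠ ∞ := by
    refine ne_top_of_le_ne_top (ENNReal.ofReal_ne_top (r := thetaQ z t - 1)) ?_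
    rw [ofReal_thetaQ_sub_one z t ht, tsum_thetaTerm_eq_tsum_coset z t]
    exact ENNReal.le_tsum r
  have h := ENNReal.summable_toReal hfin
  refine h.congr fun w => ?_
  rw [ENNReal.toReal_ofReal (Real.exp_pos _).le]

/-- `∫⁻_{S'} e^{-a/Im w} dμ(w) = 1/a` (`a > 0`). [folklore] -/
theorem setLIntegral_stripFD_exp {a : ℝ} (ha : 0 < a) :
    ∫⁻ w in stripFD, ENNReal.ofReal (Real.exp (-a / w.im)) = ENNReal.ofReal (1 / a) := by
  have hm : Measurable fun w : ℍ => ENNReal.ofReal (Real.exp (-a / w.im)) :=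
    ENNReal.measurable_ofReal.comp (Real.continuous_exp.measurable.comp
      (measurable_const.div UpperHalfPlane.continuous_im.measurable))
  rw [setLIntegral_stripFD_eq _ hm]
  have hfib : ∀ y ∈ Ioi (0 : ℝ), (∫⁻ x in Ico (0 : ℝ) 1, ENNReal.ofReal (Real.exp (-a / (pt x y).im))) * ENNReal.ofReal ((y ^ 2)⁻¹) =
      ENNReal.ofReal (Real.exp (-a / y) * (y ^ 2)⁻¹) := by
    intro y hy
    have hy' : (0 : ℝ) < y := hy
    simp_rw [pt_im hy']
    rw [setLIntegral_const, Real.volume_Ico, sub_zero, ENNReal.ofReal_one, mul_one,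
      ← ENNReal.ofReal_mul (Real.exp_pos _).le]
  rw [setLIntegral_congr_fun measurableSet_Ioi hfib]
  obtain ⟨hint, hval⟩ := integral_exp_neg_div_mul_inv_sq ha
  rw [← ofReal_integral_eq_lintegral_ofReal hint (Eventually.of_forall fun y => by positivity), hval]

/-- The coset sum of `e^{-πtr²/Im}` at level `r`, as a (finite) real number. [folklore] -/
def cosetExpSum (t : ℝ) (r : ℕ) (z : ℍ) : ℝ := ∑' w : gammaSet 1 1 0, Real.exp (-π * t * ((r : ℝ) + 1) ^ 2 / (rowRep w • z).im)

/-- `ofReal` of the coset sum is the `ℝ≥0∞` coset sum. [folklore] -/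
theorem ofReal_cosetExpSum (z : ℍ) {t : ℝ} (ht : 0 < t) (r : ℕ) :
    ENNReal.ofReal (cosetExpSum t r z) =
      ∑' w : gammaSet 1 1 0, ENNReal.ofReal (Real.exp (-π * t * ((r : ℝ) + 1) ^ 2 / (rowRep w • z).im)) := by
  unfold cosetExpSum
  exact ENNReal.ofReal_tsum_of_nonneg (fun w => (Real.exp_pos _).le) (summable_coset_exp z ht r)

/-- `Θ_z(t) - 1 = Σ_r cosetExpSum t r z` (real numbers). [folklore] -/
theorem hasSum_cosetExpSum (z : ℍ) {t : ℝ} (ht : 0 < t) : HasSum (fun r : ℕ => cosetExpSum t r z) (thetaQ z t - 1) := by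
  have hpos : 0 ≤ thetaQ z t - 1 := by linarith [one_le_thetaQ z ht]
  have hE : ∑' r : ℕ, ENNReal.ofReal (cosetExpSum t r z) = ENNReal.ofReal (thetaQ z t - 1) := by
    simp_rw [ofReal_cosetExpSum z ht]
    rw [ofReal_thetaQ_sub_one z t ht, tsum_thetaTerm_eq_tsum_coset z t]
  have hne : ∀ r, ENNReal.ofReal (cosetExpSum t r z) ≠ ∞ := fun _ => ENNReal.ofReal_ne_top
  have h := ENNReal.hasSum_toReal (f := fun r => ENNReal.ofReal (cosetExpSum t r z)) (by rw [hE]; exact ENNReal.ofReal_ne_top)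
  rw [← ENNReal.tsum_toReal_eq hne, hE, ENNReal.toReal_ofReal hpos] at h
  have e : (fun r : ℕ => (ENNReal.ofReal (cosetExpSum t r z)).toReal) = fun r => cosetExpSum t r z := by
    funext r
    exact ENNReal.toReal_ofReal (tsum_nonneg fun w => (Real.exp_pos _).le)
  rw [e] at h
  exact h

/-- `cosetExpSum t r` is measurable in `z`. [folklore] -/
theorem measurable_cosetExpSum {t : ℝ} (ht : 0 < t) (r : ℕ) : Measurable (cosetExpSum t r) := by
  haveI : Countable (gammaSet 1 1 0) := Set.Countable.to_subtype (Set.to_countable _)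
  have hm : Measurable fun z : ℍ => ∑' w : gammaSet 1 1 0,
      ENNReal.ofReal (Real.exp (-π * t * ((r : ℝ) + 1) ^ 2 / (rowRep w • z).im)) :=
    Measurable.tsum fun w => (ENNReal.measurable_ofReal.comp (Real.continuous_exp.measurable.comp
      (measurable_const.div UpperHalfPlane.continuous_im.measurable))).comp
      (continuous_const_smul (Matrix.SpecialLinearGroup.mapGL ℝ (rowRep w) : GL (Fin 2) ℝ)).measurable
  have e : cosetExpSum t r = fun z => (∑' w : gammaSet 1 1 0,
      ENNReal.ofReal (Real.exp (-π * t * ((r : ℝ) + 1) ^ 2 / (rowRep w • z).im))).toReal := by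
    funext z
    rw [← ofReal_cosetExpSum z ht r, ENNReal.toReal_ofReal]
    exact tsum_nonneg fun w => (Real.exp_pos _).le
  rw [e]
  exact hm.ennreal_toReal

/-- `cosetExpSum ≥ 0`. [folklore] -/
theorem cosetExpSum_nonneg (t : ℝ) (r : ℕ) (z : ℍ) : 0 ≤ cosetExpSum t r z := tsum_nonneg fun _ => (Real.exp_pos _).le

/-- `Σ_r ∫⁻_𝒟 cosetExpSum t r = π/(3t)` (the level-wise masses add up to the mass of `Θ - 1`). [folklore] -/
theorem tsum_lintegral_fd_cosetExpSum {t : ℝ} (ht : 0 < t) :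
    ∑' r : ℕ, ∫⁻ z in ModularGroup.fd, ENNReal.ofReal (cosetExpSum t r z) = ENNReal.ofReal (π / (3 * t)) := by
  have h := lintegral_tsum (μ := volume.restrict ModularGroup.fd)
    fun r => ((ENNReal.measurable_ofReal.comp (measurable_cosetExpSum ht r)).aemeasurable (μ := volume.restrict ModularGroup.fd))
  simp only [Function.comp_apply] at h
  rw [← h, ← lintegral_fd_thetaQ_sub_one ht]
  refine setLIntegral_congr_fun ModularGroup.isClosed_fd.measurableSet fun z _ => ?_
  simp_rw [ofReal_cosetExpSum z ht]
  rw [ofReal_thetaQ_sub_one z t ht, tsum_thetaTerm_eq_tsum_coset z t]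

/-- The complex coset weight `Ψ_r(ζ) = e^{-πtr²/Im ζ}`. [folklore] -/
def cosetExpC (t : ℝ) (r : ℕ) (ζ : ℍ) : ℂ := (Real.exp (-π * t * ((r : ℝ) + 1) ^ 2 / ζ.im) : ℂ)

/-- `Ψ_r` is `1`-periodic. [folklore] -/
theorem cosetExpC_vadd (t : ℝ) (r : ℕ) (n : ℤ) (ζ : ℍ) : cosetExpC t r ((n : ℝ) +ᵥ ζ) = cosetExpC t r ζ := by
  simp only [cosetExpC, vadd_im]

/-- `Ψ_r` is continuous. [folklore] -/
theorem continuous_cosetExpC (t : ℝ) (r : ℕ) : Continuous (cosetExpC t r) :=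
  Complex.continuous_ofReal.comp (Real.continuous_exp.comp (continuous_const.div UpperHalfPlane.continuous_im
    fun ζ => ζ.im_pos.ne'))

/-- `(cosetExpSum : ℂ) = Σ_w Ψ_r(γ_w z)`. [folklore] -/
theorem ofReal_cosetExpSum_eq_tsum (z : ℍ) (t : ℝ) (r : ℕ) :
    ((cosetExpSum t r z : ℝ) : ℂ) = ∑' w : gammaSet 1 1 0, cosetExpC t r (rowRep w • z) := by
  unfold cosetExpSum cosetExpC
  rw [Complex.ofReal_tsum]

/-- **`𝟙_{S'} Ψ_r u ∈ L¹(ℍ)` for bounded measurable `u`.** [folklore] -/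
theorem integrable_indicator_cosetExpC_mul {u : ℍ → ℂ} (hum : AEStronglyMeasurable u volume) {B : ℝ} (hB : ∀ z, ‖u z‖ ≤ B)
    {t : ℝ} (ht : 0 < t) (r : ℕ) :
    Integrable fun w : ℍ => stripFD.indicator (fun _ => (1 : ℂ)) w * cosetExpC t r w * u w := by
  have ha : 0 < π * t * ((r : ℝ) + 1) ^ 2 := by positivity
  -- dominate by `B · 𝟙_{S'} e^{-a/Im}`
  set g : ℍ → ℝ := fun w => stripFD.indicator (fun w => Real.exp (-(π * t * ((r : ℝ) + 1) ^ 2) / w.im)) w * B with hg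
  have hgi : Integrable g := by
    have hm : Measurable fun w : ℍ => Real.exp (-(π * t * ((r : ℝ) + 1) ^ 2) / w.im) :=
      Real.continuous_exp.measurable.comp (measurable_const.div UpperHalfPlane.continuous_im.measurable)
    have hfin : ∫⁻ w, ENNReal.ofReal (stripFD.indicator (fun w => Real.exp (-(π * t * ((r : ℝ) + 1) ^ 2) / w.im)) w) ≠ ∞ := by
      have e : (fun w : ℍ => ENNReal.ofReal (stripFD.indicator (fun w => Real.exp (-(π * t * ((r : ℝ) + 1) ^ 2) / w.im)) w)) =
          stripFD.indicator fun w => ENNReal.ofReal (Real.exp (-(π * t * ((r : ℝ) + 1) ^ 2) / w.im)) := by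
        funext w; by_cases hw : w ∈ stripFD <;> simp [hw]
      rw [e, lintegral_indicator measurableSet_stripFD, setLIntegral_stripFD_exp ha]
      exact ENNReal.ofReal_ne_top
    have hi : Integrable fun w : ℍ => stripFD.indicator (fun w => Real.exp (-(π * t * ((r : ℝ) + 1) ^ 2) / w.im)) w := by
      refine ⟨((hm.indicator measurableSet_stripFD)).aestronglyMeasurable, ?_⟩
      rw [HasFiniteIntegral]
      refine lt_of_le_of_lt (lintegral_mono fun w => ?_) (lt_top_iff_ne_top.mpr hfin)
      rw [Real.enorm_eq_ofReal (Set.indicator_nonneg (fun w _ => (Real.exp_pos _).le) _)]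
    exact hi.mul_const B
  refine Integrable.mono' (g := g) hgi ?_ (Eventually.of_forall fun w => ?_)
  · exact (((aestronglyMeasurable_const.indicator measurableSet_stripFD).mul
      (continuous_cosetExpC t r).aestronglyMeasurable).mul hum)
  · simp only [hg]
    by_cases hw : w ∈ stripFD
    · rw [Set.indicator_of_mem hw, Set.indicator_of_mem hw, one_mul, norm_mul]
      simp only [cosetExpC, Complex.norm_real, Real.norm_eq_abs, abs_of_pos (Real.exp_pos _)]
      have : Real.exp (-π * t * ((r : ℝ) + 1) ^ 2 / w.im) = Real.exp (-(π * t * ((r : ℝ) + 1) ^ 2) / w.im) := by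
        congr 1; ring
      rw [this]
      exact mul_le_mul_of_nonneg_left (hB w) (Real.exp_pos _).le
    · simp [Set.indicator_of_notMem hw]

/-- **Cuspidal functions are orthogonal to `Θ - 1`**: for `u` bounded, measurable, automorphic with
vanishing horizontal means, `∫_𝒟 u(z) (Θ_z(t) - 1) dμ(z) = 0` for every `t > 0` (unfold each
gcd-class of `Θ - 1` onto the strip `S'`, where the `x`-integral of `u` vanishes).
[cite: Iwaniec2002, §3.2 (unfolding) & (3.27), PDF pp. 42, 47] -/
theorem setIntegral_fd_mul_thetaQ_sub_one_eq_zero {u : ℍ → ℂ} (hum : AEStronglyMeasurable u volume)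
    (hua : IsAutomorphic (𝒮ℒ : Subgroup (GL (Fin 2) ℝ)) u) {B : ℝ} (hB : ∀ z, ‖u z‖ ≤ B)
    (hcusp : ∀ y : ℝ, 0 < y → ∫ x in Ico (0 : ℝ) 1, u (pt x y) = 0) {t : ℝ} (ht : 0 < t) :
    ∫ z in ModularGroup.fd, u z * ((thetaQ z t - 1 : ℝ) : ℂ) = 0 := by
  -- expand `Θ - 1` level-wise
  have hexp : ∀ z : ℍ, u z * ((thetaQ z t - 1 : ℝ) : ℂ) = ∑' r : ℕ, u z * ((cosetExpSum t r z : ℝ) : ℂ) := by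
    intro z
    rw [← (hasSum_cosetExpSum z ht).tsum_eq, Complex.ofReal_tsum, tsum_mul_left]
  simp_rw [hexp]
  -- interchange `∫_𝒟` and `Σ_r`
  have hmeas : ∀ r, AEStronglyMeasurable (fun z => u z * ((cosetExpSum t r z : ℝ) : ℂ)) (volume.restrict ModularGroup.fd) :=
    fun r => (hum.mul (Complex.continuous_ofReal.measurable.comp (measurable_cosetExpSum ht r)).aestronglyMeasurable).restrict
  have hbound : ∑' r : ℕ, ∫⁻ z in ModularGroup.fd, ‖u z * ((cosetExpSum t r z : ℝ) : ℂ)‖ₑ ≠ ∞ := by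
    have hle : ∀ r, ∫⁻ z in ModularGroup.fd, ‖u z * ((cosetExpSum t r z : ℝ) : ℂ)‖ₑ ≤
        ENNReal.ofReal B * ∫⁻ z in ModularGroup.fd, ENNReal.ofReal (cosetExpSum t r z) := by
      intro r
      calc ∫⁻ z in ModularGroup.fd, ‖u z * ((cosetExpSum t r z : ℝ) : ℂ)‖ₑ
          ≤ ∫⁻ z in ModularGroup.fd, ENNReal.ofReal B * ENNReal.ofReal (cosetExpSum t r z) := by
            refine lintegral_mono fun z => ?_
            rw [enorm_mul, ← ofReal_norm, ← ofReal_norm, Complex.norm_real, Real.norm_eq_abs,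
              abs_of_nonneg (cosetExpSum_nonneg t r z)]
            exact mul_le_mul_left (ENNReal.ofReal_le_ofReal (hB z)) _
        _ = ENNReal.ofReal B * ∫⁻ z in ModularGroup.fd, ENNReal.ofReal (cosetExpSum t r z) :=
            lintegral_const_mul _ (ENNReal.measurable_ofReal.comp (measurable_cosetExpSum ht r))
    refine ne_top_of_le_ne_top (b := ENNReal.ofReal B * ENNReal.ofReal (π / (3 * t))) (ENNReal.mul_ne_top ENNReal.ofReal_ne_top
      ENNReal.ofReal_ne_top) ?_
    rw [← tsum_lintegral_fd_cosetExpSum ht, ← ENNReal.tsum_mul_left]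
    exact ENNReal.tsum_le_tsum hle
  rw [integral_tsum hmeas hbound]
  -- each level unfolds onto the strip, where the horizontal mean of `u` vanishes
  have hterm : ∀ r : ℕ, ∫ z in ModularGroup.fd, u z * ((cosetExpSum t r z : ℝ) : ℂ) = 0 := by
    intro r
    have hint := integrable_indicator_cosetExpC_mul hum hB ht r
    have hs : ∀ z : ℍ, Summable fun v : gammaSet 1 1 0 => ‖cosetExpC t r (rowRep v • z)‖ := fun z => by
      simp only [cosetExpC, Complex.norm_real, Real.norm_eq_abs, abs_of_pos (Real.exp_pos _)]
      exact summable_coset_exp z ht r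
    simp_rw [ofReal_cosetExpSum_eq_tsum _ t r]
    rw [setIntegral_fd_mul_tsum_coset hua (cosetExpC_vadd t r) hs hint]
    have hIO : IntegrableOn (fun w => cosetExpC t r w * u w) stripFD := by
      rw [← integrable_indicator_iff measurableSet_stripFD]
      refine hint.congr (Eventually.of_forall fun w => ?_)
      by_cases hw : w ∈ stripFD <;> simp [hw]
    rw [setIntegral_stripFD_eq hIO]
    have hfib : ∀ y ∈ Ioi (0 : ℝ), ((y ^ 2)⁻¹ : ℝ) • ∫ x in Ico (0 : ℝ) 1, cosetExpC t r (pt x y) * u (pt x y) = 0 := by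
      intro y hy
      have hy' : (0 : ℝ) < y := hy
      have : ∀ x : ℝ, cosetExpC t r (pt x y) = (Real.exp (-π * t * ((r : ℝ) + 1) ^ 2 / y) : ℂ) := fun x => by
        simp only [cosetExpC, pt_im hy']
      simp_rw [this]
      rw [integral_const_mul, hcusp y hy', mul_zero, smul_zero]
    rw [setIntegral_congr_fun measurableSet_Ioi hfib, integral_zero, mul_zero]
  simp_rw [hterm]
  exact tsum_zero

end ThetaCoset

/-! ## Pairing bounded weights on `𝒟` with `Λ_z(s)`: Fubini -/

section LambdaPairing

/-- For `0 < t < 1`: `Θ_w(t) - 1/t = (Θ_w(1/t) - 1)/t ≥ 0`. [folklore] -/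
theorem thetaQ_sub_inv_eq (w : ℍ) {t : ℝ} (ht : 0 < t) : thetaQ w t - t⁻¹ = t⁻¹ * (thetaQ w (1 / t) - 1) := by
  rw [thetaQ_functional_equation w ht]
  field_simp

/-- The norm of `f_modif`: `‖f_modif,w(t)‖ = Θ_w(t) - 1` for `t > 1`. [folklore] -/
theorem norm_f_modif_of_one_lt (w : ℍ) {t : ℝ} (ht : 1 < t) : ‖(thetaFEPair w).f_modif t‖ = thetaQ w t - 1 := by
  rw [f_modif_thetaFEPair, Set.indicator_of_mem (show t ∈ Ioi (1 : ℝ) from ht),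
    Set.indicator_of_notMem (fun h : t ∈ Ioo (0 : ℝ) 1 => by linarith [h.2]), add_zero]
  rw [show (thetaQ w t : ℂ) - 1 = ((thetaQ w t - 1 : ℝ) : ℂ) by push_cast; ring, Complex.norm_real, Real.norm_eq_abs,
    abs_of_nonneg (by linarith [one_le_thetaQ w (by linarith : (0 : ℝ) < t)])]

/-- … and `‖f_modif,w(t)‖ = (Θ_w(1/t) - 1)/t` for `0 < t < 1`. [folklore] -/
theorem norm_f_modif_of_lt_one (w : ℍ) {t : ℝ} (ht0 : 0 < t) (ht : t < 1) :
    ‖(thetaFEPair w).f_modif t‖ = t⁻¹ * (thetaQ w (1 / t) - 1) := by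
  rw [f_modif_thetaFEPair, Set.indicator_of_notMem (fun h : t ∈ Ioi (1 : ℝ) => by linarith [show (1 : ℝ) < t from h]),
    Set.indicator_of_mem (show t ∈ Ioo (0 : ℝ) 1 from ⟨ht0, ht⟩), zero_add]
  rw [show (thetaQ w t : ℂ) - ((t⁻¹ : ℝ) : ℂ) = ((thetaQ w t - t⁻¹ : ℝ) : ℂ) by push_cast; ring, Complex.norm_real,
    Real.norm_eq_abs, thetaQ_sub_inv_eq w ht0, abs_of_nonneg]
  exact mul_nonneg (inv_nonneg.mpr ht0.le) (by linarith [one_le_thetaQ w (by positivity : (0 : ℝ) < 1 / t)])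

/-- `f_modif,w(1) = 0`. [folklore] -/
theorem thetaFEPair_f_modif_one (w : ℍ) : (thetaFEPair w).f_modif 1 = 0 := by
  rw [f_modif_thetaFEPair, Set.indicator_of_notMem (fun h : (1 : ℝ) ∈ Ioi (1 : ℝ) => lt_irrefl (1 : ℝ) h),
    Set.indicator_of_notMem (fun h : (1 : ℝ) ∈ Ioo (0 : ℝ) 1 => lt_irrefl (1 : ℝ) h.2), add_zero]

/-- **The mass of `|f_modif|` on `𝒟`**: `π/(3t)` for `t > 1`, `π/3` for `0 < t < 1`. [folklore] -/
theorem lintegral_fd_norm_f_modif {t : ℝ} (ht : 0 < t) (ht1 : t ≠ 1) :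
    ∫⁻ w in ModularGroup.fd, ‖(thetaFEPair w).f_modif t‖ₑ = ENNReal.ofReal (if 1 < t then π / (3 * t) else π / 3) := by
  rcases lt_or_gt_of_ne ht1 with h | h
  · rw [if_neg (not_lt.mpr h.le)]
    have e : ∀ w : ℍ, ‖(thetaFEPair w).f_modif t‖ₑ = ENNReal.ofReal t⁻¹ * ENNReal.ofReal (thetaQ w (1 / t) - 1) := fun w => by
      rw [← ofReal_norm, norm_f_modif_of_lt_one w ht h, ENNReal.ofReal_mul (inv_nonneg.mpr ht.le)]
    simp_rw [e]
    rw [lintegral_const_mul _ ?_, lintegral_fd_thetaQ_sub_one (by positivity : (0 : ℝ) < 1 / t), ← ENNReal.ofReal_mul (inv_nonneg.mpr ht.le)]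
    · congr 1; field_simp
    · exact ENNReal.measurable_ofReal.comp ((continuous_thetaQ_left (by positivity : (0 : ℝ) < 1 / t)).measurable.sub measurable_const)
  · rw [if_pos h]
    have e : ∀ w : ℍ, ‖(thetaFEPair w).f_modif t‖ₑ = ENNReal.ofReal (thetaQ w t - 1) := fun w => by
      rw [← ofReal_norm, norm_f_modif_of_one_lt w h]
    simp_rw [e]
    exact lintegral_fd_thetaQ_sub_one ht

/-- The `t`-majorant `B t^{σ-1} m(t)` is finite in `L¹((0,∞))` for `0 < σ < 1`. [folklore] -/
theorem lintegral_majorant_lt_top {B σ : ℝ} (hB : 0 ≤ B) (hσ0 : 0 < σ) (hσ1 : σ < 1) :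
    ∫⁻ t in Ioi (0 : ℝ), ENNReal.ofReal (B * t ^ (σ - 1)) * ENNReal.ofReal (if 1 < t then π / (3 * t) else π / 3) < ∞ := by
  have hsplit : Ioi (0 : ℝ) = Ioc 0 1 ∪ Ioi 1 := (Ioc_union_Ioi_eq_Ioi zero_le_one).symm
  rw [hsplit, lintegral_union measurableSet_Ioi (Ioc_disjoint_Ioi le_rfl)]
  refine ENNReal.add_lt_top.mpr ⟨?_, ?_⟩
  · -- on `(0, 1]`: `B t^{σ-1} π/3`, integrable since `σ - 1 > -1`
    have hi : IntegrableOn (fun t : ℝ => B * t ^ (σ - 1) * (π / 3)) (Ioc 0 1) := by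
      have h := (intervalIntegral.intervalIntegrable_rpow' (a := 0) (b := 1) (r := σ - 1) (by linarith))
      rw [intervalIntegrable_iff_integrableOn_Ioc_of_le zero_le_one] at h
      exact (h.const_mul B).mul_const _
    refine lt_of_le_of_lt (setLIntegral_mono' measurableSet_Ioc fun t ht => ?_) hi.2
    show _ ≤ ‖B * t ^ (σ - 1) * (π / 3)‖ₑ
    rw [if_neg (not_lt.mpr ht.2), ← ENNReal.ofReal_mul (mul_nonneg hB (Real.rpow_nonneg ht.1.le _)),
      ← ofReal_norm, Real.norm_eq_abs, abs_of_nonneg]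
    exact mul_nonneg (mul_nonneg hB (Real.rpow_nonneg ht.1.le _)) (by positivity)
  · -- on `(1, ∞)`: `B t^{σ-1} π/(3t) = (Bπ/3) t^{σ-2}`, integrable since `σ - 2 < -1`
    have hi : IntegrableOn (fun t : ℝ => B * (π / 3) * t ^ (σ - 2)) (Ioi 1) :=
      ((integrableOn_Ioi_rpow_of_lt (by linarith : σ - 2 < -1) zero_lt_one).const_mul _)
    refine lt_of_le_of_lt (setLIntegral_mono' measurableSet_Ioi fun t ht => ?_) hi.2
    have ht1 : (1 : ℝ) < t := ht
    have ht0 : (0 : ℝ) < t := lt_trans zero_lt_one ht1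
    show _ ≤ ‖B * (π / 3) * t ^ (σ - 2)‖ₑ
    rw [if_pos ht1, ← ENNReal.ofReal_mul (mul_nonneg hB (Real.rpow_nonneg ht0.le _)),
      ← ofReal_norm, Real.norm_eq_abs, abs_of_nonneg (mul_nonneg (by positivity) (Real.rpow_nonneg ht0.le _))]
    apply le_of_eq
    congr 1
    rw [show σ - 2 = (σ - 1) + (-1) by ring, Real.rpow_add ht0, Real.rpow_neg_one]
    field_simp

/-- **Fubini for bounded weights on `𝒟` against `Λ₀,w(s)`**, `0 < Re s < 1`:
`w ↦ φ(w)Λ₀,w(s)` is integrable on `𝒟` and `∫_𝒟 φ Λ₀(s) dμ = ∫_0^∞ t^{s-1} (∫_𝒟 φ(w) f_modif,w(t) dμ(w)) dt`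
(the majorant `|φ| t^{σ-1} |f_modif|` has product integral `B π/3 (1/σ + 1/(1-σ))` by unfolding).
[cite: Iwaniec2002, §3.2 & (3.27) (Mellin representation of `E*`), PDF pp. 42, 47] -/
theorem integral_fd_mul_Lambda₀ {φ : ℍ → ℂ} (hφm : AEStronglyMeasurable φ volume) {B : ℝ} (hB : ∀ w, ‖φ w‖ ≤ B)
    {s : ℂ} (hs0 : 0 < s.re) (hs1 : s.re < 1) :
    IntegrableOn (fun w => φ w * (thetaFEPair w).Λ₀ s) ModularGroup.fd ∧
      ∫ w in ModularGroup.fd, φ w * (thetaFEPair w).Λ₀ s =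
        ∫ t in Ioi (0 : ℝ), (t : ℂ) ^ (s - 1) * ∫ w in ModularGroup.fd, φ w * (thetaFEPair w).f_modif t := by
  have hB0 : 0 ≤ B := (norm_nonneg _).trans (hB UpperHalfPlane.I)
  set μ : Measure ℍ := volume.restrict ModularGroup.fd with hμ
  set ν : Measure ℝ := volume.restrict (Ioi (0 : ℝ)) with hν
  set F : ℍ → ℝ → ℂ := fun w t => φ w * ((t : ℂ) ^ (s - 1) * (thetaFEPair w).f_modif t) with hF
  have hprod_le : μ.prod ν ≤ (volume : Measure ℍ).prod ν := Measure.prod_mono Measure.restrict_le_self le_rfl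
  have hφμ : AEStronglyMeasurable φ μ := hφm.mono_measure Measure.restrict_le_self
  have hmeas : AEStronglyMeasurable (Function.uncurry F) (μ.prod ν) := by
    show AEStronglyMeasurable (fun p : ℍ × ℝ => φ p.1 * (((p.2 : ℝ) : ℂ) ^ (s - 1) * (thetaFEPair p.1).f_modif p.2)) (μ.prod ν)
    refine (hφμ.comp_quasiMeasurePreserving (Measure.quasiMeasurePreserving_fst (μ := μ) (ν := ν))).mul ?_
    exact ((((Complex.measurable_ofReal.comp measurable_snd).pow_const _).aestronglyMeasurable).mul
      (aestronglyMeasurable_f_modif_prod.mono_measure hprod_le))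
  -- finiteness of the product integral of the norm, by Tonelli in the order `t` outside
  have hfin : ∫⁻ p, ‖Function.uncurry F p‖ₑ ∂(μ.prod ν) < ∞ := by
    rw [lintegral_prod_symm _ hmeas.aemeasurable.enorm]
    have hle : ∀ t ∈ Ioi (0 : ℝ), t ≠ 1 → ∫⁻ w, ‖Function.uncurry F (w, t)‖ₑ ∂μ ≤
        ENNReal.ofReal (B * t ^ (s.re - 1)) * ENNReal.ofReal (if 1 < t then π / (3 * t) else π / 3) := by
      intro t ht ht1
      have ht' : (0 : ℝ) < t := ht
      rw [← lintegral_fd_norm_f_modif ht' ht1, hμ, ← lintegral_const_mul' _ _ ENNReal.ofReal_ne_top]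
      refine lintegral_mono fun w => ?_
      simp only [Function.uncurry, hF]
      rw [enorm_mul, enorm_mul, ← mul_assoc]
      refine mul_le_mul_left ?_ _
      rw [← ofReal_norm, ← ofReal_norm, ← ENNReal.ofReal_mul (norm_nonneg _),
        Complex.norm_cpow_eq_rpow_re_of_pos ht', Complex.sub_re, Complex.one_re]
      exact ENNReal.ofReal_le_ofReal (mul_le_mul_of_nonneg_right (hB w) (Real.rpow_nonneg ht'.le _))
    calc ∫⁻ t, ∫⁻ w, ‖Function.uncurry F (w, t)‖ₑ ∂μ ∂ν
        ≤ ∫⁻ t, ENNReal.ofReal (B * t ^ (s.re - 1)) * ENNReal.ofReal (if 1 < t then π / (3 * t) else π / 3) ∂ν := by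
          refine lintegral_mono_ae ?_
          rw [hν, ae_restrict_iff' measurableSet_Ioi]
          have h1 : ∀ᵐ t : ℝ, t ≠ 1 := by
            have : (volume : Measure ℝ) {1} = 0 := Real.volume_singleton
            exact (measure_eq_zero_iff_ae_notMem.mp this).mono fun t ht h => ht (by simpa using h)
          filter_upwards [h1] with t ht1 ht
          exact hle t ht ht1
      _ < ∞ := lintegral_majorant_lt_top hB0 hs0 hs1
  have hint : Integrable (Function.uncurry F) (μ.prod ν) := ⟨hmeas, hfin⟩
  have hswap := integral_integral_swap hint
  have hL : ∀ w, ∫ t, F w t ∂ν = φ w * (thetaFEPair w).Λ₀ s := by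
    intro w
    simp only [hF, hν]
    rw [integral_const_mul, WeakFEPair.Λ₀, mellin]
    simp_rw [smul_eq_mul]
  have hR : ∀ t, ∫ w, F w t ∂μ = (t : ℂ) ^ (s - 1) * ∫ w in ModularGroup.fd, φ w * (thetaFEPair w).f_modif t := by
    intro t
    simp only [hF, hμ]
    rw [← integral_const_mul]
    congr 1 with w; ring
  refine ⟨?_, ?_⟩
  · have h := hint.integral_prod_left
    have e : (fun w => ∫ t, Function.uncurry F (w, t) ∂ν) = fun w => φ w * (thetaFEPair w).Λ₀ s := by
      funext w; exact hL w
    rw [e] at h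
    exact h
  · calc ∫ w in ModularGroup.fd, φ w * (thetaFEPair w).Λ₀ s = ∫ w, ∫ t, F w t ∂ν ∂μ := by simp_rw [hL]; rfl
      _ = ∫ t, ∫ w, F w t ∂μ ∂ν := hswap
      _ = ∫ t in Ioi (0 : ℝ), (t : ℂ) ^ (s - 1) * ∫ w in ModularGroup.fd, φ w * (thetaFEPair w).f_modif t := by
          simp_rw [hR]; rfl

/-- The `t`-fibres of the pairing: `∫_𝒟 φ f_modif(t) = ∫_𝒟 φ (Θ(t) - 1) + 𝟙_{t<1} (1 - t⁻¹) ∫_𝒟 φ`. [folklore] -/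
theorem integral_fd_mul_f_modif {φ : ℍ → ℂ} (hφm : AEStronglyMeasurable φ volume) {B : ℝ} (hB : ∀ w, ‖φ w‖ ≤ B)
    {t : ℝ} (ht : 0 < t) :
    ∫ w in ModularGroup.fd, φ w * (thetaFEPair w).f_modif t =
      (if t = 1 then 0 else ∫ w in ModularGroup.fd, φ w * ((thetaQ w t - 1 : ℝ) : ℂ)) +
        (if t < 1 then (1 - (t⁻¹ : ℂ)) * ∫ w in ModularGroup.fd, φ w else 0) := by
  rcases lt_trichotomy t 1 with h | rfl | h
  · rw [if_neg h.ne, if_pos h]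
    have e : ∀ w : ℍ, φ w * (thetaFEPair w).f_modif t = φ w * ((thetaQ w t - 1 : ℝ) : ℂ) + (1 - (t⁻¹ : ℂ)) * φ w := by
      intro w
      rw [f_modif_thetaFEPair, Set.indicator_of_notMem (fun h' : t ∈ Ioi (1 : ℝ) => by linarith [show (1 : ℝ) < t from h']),
        Set.indicator_of_mem (show t ∈ Ioo (0 : ℝ) 1 from ⟨ht, h⟩), zero_add]
      push_cast; ring
    simp_rw [e]
    haveI : IsFiniteMeasure (volume.restrict ModularGroup.fd) := isFiniteMeasure_restrict_fd
    have hφi : IntegrableOn φ ModularGroup.fd :=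
      Measure.integrableOn_of_bounded (volume_modular_fd_lt_top.ne) hφm (Eventually.of_forall hB)
    have h1 : IntegrableOn (fun w => φ w * ((thetaQ w t - 1 : ℝ) : ℂ)) ModularGroup.fd := by
      -- bounded by `B (Θ - 1)`, whose mass is `π/(3t)`
      refine Integrable.mono' (g := fun w => B * (thetaQ w t - 1)) ?_ ?_ (Eventually.of_forall fun w => ?_)
      · have hm : AEStronglyMeasurable (fun w : ℍ => thetaQ w t - 1) (volume.restrict ModularGroup.fd) :=
          ((continuous_thetaQ_left ht).sub continuous_const).aestronglyMeasurable
        refine (Integrable.const_mul ⟨hm, ?_⟩ B)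
        rw [HasFiniteIntegral]
        have e2 : ∀ w : ℍ, ‖thetaQ w t - 1‖ₑ = ENNReal.ofReal (thetaQ w t - 1) := fun w =>
          (Real.enorm_eq_ofReal (by linarith [one_le_thetaQ w ht]))
        simp_rw [e2]
        rw [lintegral_fd_thetaQ_sub_one ht]; exact ENNReal.ofReal_lt_top
      · exact (hφm.restrict.mul (Complex.continuous_ofReal.comp_aestronglyMeasurable
          ((continuous_thetaQ_left ht).sub continuous_const).aestronglyMeasurable))
      · rw [norm_mul, Complex.norm_real, Real.norm_eq_abs, abs_of_nonneg (by linarith [one_le_thetaQ w ht])]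
        have hθ0 : 0 ≤ thetaQ w t - 1 := by linarith [one_le_thetaQ w ht]
        calc ‖φ w‖ * (thetaQ w t - 1) ≤ B * (thetaQ w t - 1) := mul_le_mul_of_nonneg_right (hB w) hθ0
          _ = B * (thetaQ w t - 1) := rfl
    rw [integral_add h1 (hφi.const_mul _), integral_const_mul]
  · rw [if_pos rfl, if_neg (lt_irrefl _), add_zero]
    simp_rw [thetaFEPair_f_modif_one, mul_zero, integral_zero]
  · rw [if_neg h.ne', if_neg (not_lt.mpr h.le), add_zero]
    congr 1 with w
    rw [f_modif_thetaFEPair, Set.indicator_of_mem (show t ∈ Ioi (1 : ℝ) from h),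
      Set.indicator_of_notMem (fun h' : t ∈ Ioo (0 : ℝ) 1 => by linarith [h'.2]), add_zero]
    push_cast; ring

/-- **Orthogonality to `Λ_z(s)`**: a bounded weight `φ` on `𝒟` with `∫_𝒟 φ (Θ(t) - 1) = 0` for all
`t > 0` and `∫_𝒟 φ = 0` pairs to zero with `Λ_z(s)` (`0 < Re s < 1`). [folklore] -/
theorem integral_fd_mul_Lambda_eq_zero {φ : ℍ → ℂ} (hφm : AEStronglyMeasurable φ volume) {B : ℝ} (hB : ∀ w, ‖φ w‖ ≤ B)
    (hθ : ∀ t : ℝ, 0 < t → ∫ w in ModularGroup.fd, φ w * ((thetaQ w t - 1 : ℝ) : ℂ) = 0)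
    (h1 : ∫ w in ModularGroup.fd, φ w = 0) {s : ℂ} (hs0 : 0 < s.re) (hs1 : s.re < 1) :
    ∫ w in ModularGroup.fd, φ w * (thetaFEPair w).Λ s = 0 := by
  obtain ⟨hint, hfub⟩ := integral_fd_mul_Lambda₀ hφm hB hs0 hs1
  haveI : IsFiniteMeasure (volume.restrict ModularGroup.fd) := isFiniteMeasure_restrict_fd
  have hφi : IntegrableOn φ ModularGroup.fd :=
    Measure.integrableOn_of_bounded (volume_modular_fd_lt_top.ne) hφm (Eventually.of_forall hB)
  have e : ∀ w : ℍ, φ w * (thetaFEPair w).Λ s = φ w * (thetaFEPair w).Λ₀ s - (1 / s) * φ w - (1 / (1 - s)) * φ w := by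
    intro w
    rw [WeakFEPair.Λ]
    simp only [thetaFEPair, smul_eq_mul, one_div]
    push_cast
    ring
  simp_rw [e]
  have hA : Integrable (fun w => φ w * (thetaFEPair w).Λ₀ s - 1 / s * φ w) (volume.restrict ModularGroup.fd) :=
    hint.sub (hφi.const_mul _)
  have hB' : Integrable (fun w => 1 / (1 - s) * φ w) (volume.restrict ModularGroup.fd) := hφi.const_mul _
  have hC' : Integrable (fun w => 1 / s * φ w) (volume.restrict ModularGroup.fd) := hφi.const_mul _
  rw [integral_sub hA hB', integral_sub hint hC', integral_const_mul, integral_const_mul, h1, mul_zero, mul_zero,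
    sub_zero, sub_zero, hfub]
  refine setIntegral_eq_zero_of_forall_eq_zero fun t ht => ?_
  rw [integral_fd_mul_f_modif hφm hB ht, h1, mul_zero]
  by_cases h : t = 1
  · simp [h]
  · rw [if_neg h, hθ t ht]; simp

/-- `E(z, s) = Λ_z(s) / (2 Λ(2s))`. [folklore] -/
theorem eisen_eq_Lambda (z : ℍ) (s : ℂ) : eisen z s = (thetaFEPair z).Λ s / 2 / completedRiemannZeta (2 * s) := rfl

/-- **Orthogonality to the Eisenstein series** for weights as in `integral_fd_mul_Lambda_eq_zero`:
`∫_𝒟 φ(z) E(z, s) dμ(z) = 0` for `0 < Re s < 1`. [cite: Iwaniec2002, (7.11)–(7.13) & Thm 7.3, PDF pp. 100–101] -/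
theorem integral_fd_mul_eisen_eq_zero {φ : ℍ → ℂ} (hφm : AEStronglyMeasurable φ volume) {B : ℝ} (hB : ∀ w, ‖φ w‖ ≤ B)
    (hθ : ∀ t : ℝ, 0 < t → ∫ w in ModularGroup.fd, φ w * ((thetaQ w t - 1 : ℝ) : ℂ) = 0)
    (h1 : ∫ w in ModularGroup.fd, φ w = 0) {s : ℂ} (hs0 : 0 < s.re) (hs1 : s.re < 1) :
    ∫ w in ModularGroup.fd, φ w * eisen w s = 0 := by
  have e : ∀ w : ℍ, φ w * eisen w s = (1 / 2 / completedRiemannZeta (2 * s)) * (φ w * (thetaFEPair w).Λ s) := by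
    intro w; rw [eisen_eq_Lambda]; ring
  simp_rw [e]
  rw [integral_const_mul, integral_fd_mul_Lambda_eq_zero hφm hB hθ h1 hs0 hs1, mul_zero]

variable {u : ℍ → ℂ} {t : ℂ}

/-- A Maass cusp form is bounded on `ℍ` (continuity on a truncation of `𝒟`, decay in the cusp,
automorphy). [cite: Iwaniec2002, Cor. 4.4 / (8.2'), PDF pp. 50, 107] -/
theorem IsMaassCuspForm.exists_bound (h : IsMaassCuspForm u t)
    (hL2 : IntegrableOn (fun z => ‖u z‖ ^ 2) ModularGroup.fd) : ∃ B : ℝ, ∀ z : ℍ, ‖u z‖ ≤ B := by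
  by_cases hne : ∃ z, u z ≠ 0
  · obtain ⟨C, Y₀, hC, hY₀, hdec⟩ := h.exists_norm_sq_le hL2 hne
    -- on `𝒟 ∩ {Im ≤ Y₀}` by compactness, above by the decay, elsewhere by automorphy
    obtain ⟨B₁, hB₁⟩ := (isCompact_fdTrunc Y₀).exists_bound_of_continuousOn h.continuous.continuousOn
    refine ⟨max B₁ (Real.sqrt C), fun z => ?_⟩
    obtain ⟨γ, hγ, hγz⟩ := modular_fd_covers z
    rw [← h.automorphic γ hγ z]
    by_cases hy : (γ • z).im ≤ Y₀
    · exact (hB₁ _ ⟨hγz, hy⟩).trans (le_max_left _ _)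
    · have hy' : Y₀ ≤ (γ • z).im := (not_le.mp hy).le
      have h1 := hdec _ hy'
      have h2 : C / (γ • z).im ≤ C := div_le_self hC (hY₀.trans hy')
      have h3 : ‖u (γ • z)‖ ≤ Real.sqrt C := by
        rw [← Real.sqrt_sq (norm_nonneg _)]
        exact Real.sqrt_le_sqrt (h1.trans h2)
      exact h3.trans (le_max_right _ _)
  · simp only [not_exists, not_not] at hne
    exact ⟨0, fun z => by rw [hne z, norm_zero]⟩

/-- Horizontal means over `[0, 1)` vanish for a Maass cusp form. [folklore] -/
theorem IsMaassCuspForm.setIntegral_Ico_eq_zero (h : IsMaassCuspForm u t) {y : ℝ} (hy : 0 < y) :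
    ∫ x in Ico (0 : ℝ) 1, u (pt x y) = 0 := by
  have h0 := h.cuspidal (pt 0 y)
  rw [← intervalIntegral_pt_eq_cuspMean u hy, intervalIntegral.integral_of_le zero_le_one] at h0
  rwa [integral_Ico_eq_integral_Ioc]

/-- **Maass cusp forms are orthogonal to the Eisenstein series**: for a Maass cusp form `u` of
`SL₂(ℤ)` (square integrable, real spectral parameter) and `0 < Re s < 1` — in particular on the
critical line — `∫_𝒟 ū(z) E(z, s) dμ(z) = 0`. [cite: Iwaniec2002, (7.13) & Thm 7.3, PDF pp. 100–101] -/
theorem IsMaassCuspForm.integral_fd_conj_mul_eisen (h : IsMaassCuspForm u t)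
    (hL2 : IntegrableOn (fun z => ‖u z‖ ^ 2) ModularGroup.fd) (ht : t.im = 0) {s : ℂ} (hs0 : 0 < s.re) (hs1 : s.re < 1) :
    ∫ z in ModularGroup.fd, conj (u z) * eisen z s = 0 := by
  obtain ⟨B, hB⟩ := h.exists_bound hL2
  have hφm : AEStronglyMeasurable (fun z => conj (u z)) volume := (Complex.continuous_conj.comp h.continuous).aestronglyMeasurable
  have hB' : ∀ z, ‖conj (u z)‖ ≤ B := fun z => by rw [Complex.norm_conj]; exact hB z
  have hua : IsAutomorphic (𝒮ℒ : Subgroup (GL (Fin 2) ℝ)) fun z => conj (u z) := fun γ hγ z => by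
    simp only [h.automorphic γ hγ z]
  have hcusp : ∀ y : ℝ, 0 < y → ∫ x in Ico (0 : ℝ) 1, conj (u (pt x y)) = 0 := fun y hy => by
    rw [integral_conj, h.setIntegral_Ico_eq_zero hy, map_zero]
  have hθ : ∀ τ : ℝ, 0 < τ → ∫ w in ModularGroup.fd, conj (u w) * ((thetaQ w τ - 1 : ℝ) : ℂ) = 0 := fun τ hτ =>
    setIntegral_fd_mul_thetaQ_sub_one_eq_zero hφm hua hB' hcusp hτ
  have h1 : ∫ w in ModularGroup.fd, conj (u w) = 0 := by
    rw [integral_conj, h.setIntegral_fd_eq_zero hL2 ht, map_zero]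
  exact integral_fd_mul_eisen_eq_zero hφm hB' hθ h1 hs0 hs1

/-- … in particular `∫_𝒟 ū(z) E(z, 1/2 + ir) dμ(z) = 0` for every real `r` (`eisensteinCrit` for `r ≠ 0`).
[cite: Iwaniec2002, Thm 7.3, PDF p. 101] -/
theorem IsMaassCuspForm.integral_fd_conj_mul_eisensteinCrit (h : IsMaassCuspForm u t)
    (hL2 : IntegrableOn (fun z => ‖u z‖ ^ 2) ModularGroup.fd) (ht : t.im = 0) {r : ℝ} (hr : r ≠ 0) :
    ∫ z in ModularGroup.fd, conj (u z) * eisensteinCrit z r = 0 := by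
  have h' := h.integral_fd_conj_mul_eisen hL2 ht (s := critS r) (by simp [critS]) (by simp [critS]; norm_num)
  simp_rw [eisen_critS _ hr] at h'
  exact h'

/-- `∫_𝒟 (Θ_w(t) - 1) dμ = π/(3t)` as a complex Bochner integral. [folklore] -/
theorem integral_fd_thetaQ_sub_one {t : ℝ} (ht : 0 < t) :
    ∫ w in ModularGroup.fd, ((thetaQ w t - 1 : ℝ) : ℂ) = ((π / (3 * t) : ℝ) : ℂ) := by
  rw [integral_complex_ofReal]
  congr 1
  have hm : AEStronglyMeasurable (fun w : ℍ => thetaQ w t - 1) (volume.restrict ModularGroup.fd) :=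
    ((continuous_thetaQ_left ht).sub continuous_const).aestronglyMeasurable
  rw [integral_eq_lintegral_of_nonneg_ae (Eventually.of_forall fun w => by simp only [Pi.zero_apply]; linarith [one_le_thetaQ w ht]) hm,
    lintegral_fd_thetaQ_sub_one ht, ENNReal.toReal_ofReal (by positivity)]

/-- `∫_𝒟 1 dμ = π/3` (Mathlib normalisation; `volume_modular_fd`). [cite: Iwaniec2002, (3.26), PDF p. 47] -/
theorem integral_fd_one : ∫ _w in ModularGroup.fd, (1 : ℂ) = ((π / 3 : ℝ) : ℂ) := by
  rw [setIntegral_const, Measure.real, volume_modular_fd, ENNReal.toReal_ofReal (by positivity)]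
  simp

/-- **The constant function is orthogonal to the Eisenstein series**: `∫_𝒟 E(z, s) dμ(z) = 0` for
`0 < Re s < 1`: `∫_𝒟 Λ₀ = (π/3)(1/s + 1/(1-s))` cancels the polar part `(1/s + 1/(1-s)) |𝒟|`.
[cite: Iwaniec2002, (7.11)–(7.12) & (6.33), PDF pp. 92, 100] -/
theorem integral_fd_eisen_eq_zero {s : ℂ} (hs0 : 0 < s.re) (hs1 : s.re < 1) : ∫ z in ModularGroup.fd, eisen z s = 0 := by
  have hφm : AEStronglyMeasurable (fun _ : ℍ => (1 : ℂ)) volume := aestronglyMeasurable_const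
  have hB : ∀ w : ℍ, ‖(fun _ : ℍ => (1 : ℂ)) w‖ ≤ 1 := fun w => by simp
  obtain ⟨hint, hfub⟩ := integral_fd_mul_Lambda₀ hφm hB hs0 hs1
  simp only [one_mul] at hint hfub
  -- the fibres
  have hJ : ∀ τ ∈ Ioi (0 : ℝ), τ ≠ 1 → ∫ w in ModularGroup.fd, (thetaFEPair w).f_modif τ =
      ((if τ < 1 then π / 3 else π / (3 * τ) : ℝ) : ℂ) := by
    intro τ hτ hτ1
    have h := integral_fd_mul_f_modif hφm hB (t := τ) hτ
    simp only [one_mul] at h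
    rw [h, if_neg hτ1, integral_fd_thetaQ_sub_one hτ, integral_fd_one]
    by_cases hlt : τ < 1
    · rw [if_pos hlt, if_pos hlt]
      have hτ0 : (τ : ℂ) ≠ 0 := by exact_mod_cast (ne_of_gt hτ)
      push_cast
      field_simp
      ring
    · rw [if_neg hlt, if_neg hlt, add_zero]
  -- `∫_𝒟 Λ₀(s) = (π/3)(1/s + 1/(1-s))`
  have hs_ne : s ≠ 0 := fun h => by rw [h, Complex.zero_re] at hs0; exact lt_irrefl _ hs0
  have h1s_ne : (1 : ℂ) - s ≠ 0 := fun h => by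
    have := congrArg Complex.re h; simp at this; linarith
  have hΛ₀ : ∫ w in ModularGroup.fd, (thetaFEPair w).Λ₀ s = ((π / 3 : ℝ) : ℂ) * (1 / s + 1 / (1 - s)) := by
    rw [hfub]
    have hsplit : Ioi (0 : ℝ) = Ioc 0 1 ∪ Ioi 1 := (Ioc_union_Ioi_eq_Ioi zero_le_one).symm
    -- integrability of the two pieces
    have hlow : IntegrableOn (fun τ : ℝ => (τ : ℂ) ^ (s - 1) * ((π / 3 : ℝ) : ℂ)) (Ioc 0 1) := by
      refine Integrable.mul_const ?_ _
      have h := intervalIntegral.intervalIntegrable_cpow' (a := 0) (b := 1) (r := s - 1) (by simp; linarith)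
      exact (intervalIntegrable_iff_integrableOn_Ioc_of_le zero_le_one).mp h
    have hhigh : IntegrableOn (fun τ : ℝ => ((π / 3 : ℝ) : ℂ) * (τ : ℂ) ^ (s - 2)) (Ioi 1) :=
      (integrableOn_Ioi_cpow_of_lt (by simp; linarith) zero_lt_one).const_mul _
    have hcongr_low : ∀ τ ∈ Ioc (0 : ℝ) 1, τ ≠ 1 →
        (τ : ℂ) ^ (s - 1) * ∫ w in ModularGroup.fd, (thetaFEPair w).f_modif τ = (τ : ℂ) ^ (s - 1) * ((π / 3 : ℝ) : ℂ) := by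
      intro τ hτ hτ1
      rw [hJ τ hτ.1 hτ1, if_pos (lt_of_le_of_ne hτ.2 hτ1)]
    have hcongr_high : ∀ τ ∈ Ioi (1 : ℝ),
        (τ : ℂ) ^ (s - 1) * ∫ w in ModularGroup.fd, (thetaFEPair w).f_modif τ = ((π / 3 : ℝ) : ℂ) * (τ : ℂ) ^ (s - 2) := by
      intro τ hτ
      have hτ1 : (1 : ℝ) < τ := hτ
      have hτ0 : (0 : ℝ) < τ := by linarith
      rw [hJ τ hτ0 hτ1.ne', if_neg (not_lt.mpr hτ1.le)]
      have hτc : (τ : ℂ) ≠ 0 := by exact_mod_cast hτ0.ne'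
      rw [show s - 2 = (s - 1) + (-1) by ring, Complex.cpow_add _ _ hτc, Complex.cpow_neg_one]
      push_cast
      field_simp
    have hae1 : ∀ᵐ τ : ℝ, τ ≠ 1 :=
      (measure_eq_zero_iff_ae_notMem.mp (Real.volume_singleton (a := 1))).mono fun τ hτ h => hτ (by simpa using h)
    have hae_low : (fun τ : ℝ => (τ : ℂ) ^ (s - 1) * ∫ w in ModularGroup.fd, (thetaFEPair w).f_modif τ) =ᵐ[volume.restrict (Ioc 0 1)]
        fun τ : ℝ => (τ : ℂ) ^ (s - 1) * ((π / 3 : ℝ) : ℂ) := by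
      rw [Filter.EventuallyEq, ae_restrict_iff' measurableSet_Ioc]
      filter_upwards [hae1] with τ hτ1 hτ
      exact hcongr_low τ hτ hτ1
    have hae_high : (fun τ : ℝ => (τ : ℂ) ^ (s - 1) * ∫ w in ModularGroup.fd, (thetaFEPair w).f_modif τ) =ᵐ[volume.restrict (Ioi 1)]
        fun τ : ℝ => ((π / 3 : ℝ) : ℂ) * (τ : ℂ) ^ (s - 2) := by
      rw [Filter.EventuallyEq, ae_restrict_iff' measurableSet_Ioi]
      exact Eventually.of_forall hcongr_high
    rw [hsplit, setIntegral_union (Ioc_disjoint_Ioi le_rfl) measurableSet_Ioi (hlow.congr hae_low.symm) (hhigh.congr hae_high.symm),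
      integral_congr_ae hae_low, integral_congr_ae hae_high, integral_mul_const, integral_const_mul,
      ← intervalIntegral.integral_of_le zero_le_one, integral_cpow (Or.inl (by simp; linarith)),
      integral_Ioi_cpow_of_lt (by simp; linarith) zero_lt_one]
    have e1 : s - 1 + 1 = s := by ring
    have e2 : s - 2 + 1 = -(1 - s) := by ring
    rw [e1, e2]
    push_cast
    rw [Complex.one_cpow, Complex.zero_cpow hs_ne, Complex.one_cpow]
    have hneg : -(1 - s) ≠ 0 := neg_ne_zero.mpr h1s_ne
    field_simp
    ring
  -- `∫_𝒟 Λ(s) = 0`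
  haveI : IsFiniteMeasure (volume.restrict ModularGroup.fd) := isFiniteMeasure_restrict_fd
  have h1i : IntegrableOn (fun _ : ℍ => (1 : ℂ)) ModularGroup.fd := integrableOn_const (volume_modular_fd_lt_top.ne)
  have eΛ : ∀ w : ℍ, eisen w s = (1 / 2 / completedRiemannZeta (2 * s)) *
      ((thetaFEPair w).Λ₀ s - (1 / s) * 1 - (1 / (1 - s)) * 1) := by
    intro w
    rw [eisen_eq_Lambda, WeakFEPair.Λ]
    simp only [thetaFEPair, smul_eq_mul, one_div]
    push_cast
    ring
  simp_rw [eΛ]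
  have hA : Integrable (fun w => (thetaFEPair w).Λ₀ s - 1 / s * 1) (volume.restrict ModularGroup.fd) := hint.sub (h1i.const_mul _)
  rw [integral_const_mul, integral_sub hA (h1i.const_mul _), integral_sub hint (h1i.const_mul _), integral_const_mul,
    integral_const_mul, integral_fd_one, hΛ₀]
  field_simp
  ring

/-- … in particular `∫_𝒟 E(z, 1/2 + ir) dμ(z) = 0` (`r ≠ 0`, `eisensteinCrit`). [cite: Iwaniec2002, Thm 7.3, PDF p. 101] -/
theorem integral_fd_eisensteinCrit_eq_zero {r : ℝ} (hr : r ≠ 0) : ∫ z in ModularGroup.fd, eisensteinCrit z r = 0 := by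
  have h' := integral_fd_eisen_eq_zero (s := critS r) (by simp [critS]) (by simp [critS]; norm_num)
  simp_rw [eisen_critS _ hr] at h'
  exact h'

end LambdaPairing

end Literature.NumberTheory.Automorphic

end
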